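import Mathlib
import Literature.MathematicalPhysics.QuantumLattice.RossiWolffOneLinkIntegral
import Literature.MathematicalPhysics.StatisticalMechanics.ComplexSpinFluctuationFiveSixCertificate
import Literature.MathematicalPhysics.QuantumLattice.GrassmannIntegralProofs
import HarnessLib

/-!
# Bosonisation of `β = 0` `U(N)` lattice gauge theory with staggered fermions: the complex spin system
# (Salmhofer–Seiler, CMP 139 (1991), §2 (2.19)–(2.24) and Remark 3.4(2))

Salmhofer–Seiler, §2 "Gauge Field Integration at Strong Coupling" (pp. 400–401): at infinite bare
coupling `β = 0` (and four-fermion coupling `g₄ = 0`) the `U(N)` lattice gauge theory with staggered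
fermions, action (2.3)
`S_F = ∑_x (½ ∑_μ Γ_μ(x) (ψ̄(x)U_μ(x)ψ(x+e_μ) - ψ̄(x+e_μ)U_μ(x)⁻¹ψ(x)) - m ψ̄ψ(x))`,
partition function `Z_Λ = ∫ 𝒟_Λψψ̄ 𝒟_ΛU e^{-S}` (2.9) and expectations (2.10), becomes after the
one-link integrals (2.16)–(2.17) "a purely fermionic system"
`Z_Λ = ∫ 𝒟_Λψψ̄ exp(∑_x m ψ̄ψ(x) + ∑_{x,μ} W̃(¼ ψ̄ψ(x) ψ̄ψ(x+e_μ)))` (2.19), and after the site-wise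
bosonisation `∫ dψdψ̄ f(ψ̄ψ) = N! ∮ dσ̃/(2πiσ̃) σ̃^{-N} f(σ̃)` (2.20) with `σ_x = σ̃/2N` the complex spin
system (2.21)–(2.23): `⟨F⟩_Λ = Z_Λ⁻¹ ∮ ∏_x dσ_x/(2πiσ_x) σ_x^{-N} e^{2Nmσ_x} · e^{N∑ W(σ_xσ_{x+e_μ})} F`,
`B(t) = e^{NW(t)} = ∑_k b_k t^k`, `b_k = (N-k)! N^{2k}/(N! k!)` (2.23); in particular
`⟨ψ̄ψ(x)⟩_Λ = 2N⟨σ_x⟩_Λ` (2.24) (Remark 3.4(2): "`U(N)` lattice gauge theory at `β = 0` is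
equivalent to [the complex spin system] with `W` given by (2.22)").

This file PROVES these statements (no named fact), the complex spin side being the tree's
coefficient-extraction rendering `ComplexSpin.siteWeight/bondWeight/uNBondCoeff/boltzmann/bracket/
partitionFunction/expect` of `ComplexSpinInfraredBound.lean` (Remark 3.2: the contour integrals extract
the coefficient of `∏_x σ_x^N`), the gauge side being honest Berezin–Haar integrals: the tree's Grassmann
algebra (`GrassmannIntegral.lean`) on generators `ψ̄_a(x), ψ_a(x)`, the Haar probability measure on
`U(N)` (`GaugeGroups.lean`), the coefficientwise gauge-field integral `GrassmannAlgebra.cintegral`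
(`GrassmannCoefficientIntegral.lean`), the pair calculus (`GrassmannPairCalculus.lean`) and the
Rossi–Wolff one-link integral (`RossiWolffOneLinkIntegral.lean`).

## Main statements

* `berezin_mesonPoly` — **(2.20), all sites at once**: for a polynomial `Φ` in commuting variables
  `σ_x`, `∫dψ̄dψ Φ(c ψ̄ψ) = ε (c^N N!)^{|Λ|} [∏_x σ_x^N] Φ` (`ε = (-1)^{n(n-1)/2}`, `n = N|Λ|`, the
  orientation sign of the tree's Berezin integral; with the paper's ordering `∏ dψ_a dψ̄_a`, `ε = 1`);
* `gaugeAverage_eq` — **(2.19)**: for links `b ↦ (x_b, y_b)` with `x_b ≠ y_b` and signs `Γ_b² = 1`,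
  `∫ 𝒟U e^{-S_F} = ∏_x e^{m ψ̄ψ(x)} ∏_b B̃(¼ ψ̄ψ(x_b)ψ̄ψ(y_b))`, `B̃(t) = ∑_k (N-k)!/(N!k!) t^k`;
* `gaugeAverage_torus` — on the torus `(ℤ/Lℤ)^ν` (`L ≥ 2`, links `(x, x+e_μ)`) this is the complex-spin
  Boltzmann polynomial `∏_x F(σ_x) ∏_{x,μ} B(σ_xσ_{x+e_μ})` read at `σ_x = ψ̄ψ(x)/2N` (2.21)–(2.23);
* `fermiBracket_spinObs` — **(2.21)/Remark 3.4(2) with the constants**: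
  `∫ 𝒟ψψ̄ 𝒟U e^{-S} Φ(ψ̄ψ/2N) = ε (N!)^{|Λ|} (2N)^{-N|Λ|} · [Φ]_Λ` for every real polynomial `Φ`,
  `[Φ]_Λ = ComplexSpin.bracket N m (uNBondCoeff N) Φ`; `fermiZ_eq` (partition functions);
* `fermiExpect_spinObs` — **(2.21)**: `⟨Φ(ψ̄ψ/2N)⟩_{S,Λ} = ⟨Φ⟩_Λ` ("dropping global constants");
  `fermiExpect_meson` — **(2.24)**: `⟨ψ̄ψ(x)⟩_Λ = 2N⟨σ_x⟩_Λ`;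
* `negAction_torus_eq_staggeredDirac`, `fermiBoltzmann_torus_eq_staggeredDirac` — faithfulness to the
  tree's lattice Dirac operator: with the staggered signs `Γ_μ(x) = η_μ(x)` (2.4) and the links
  `(x, x+e_μ)`, `-S_F = ψ̄(-D)ψ` and `e^{-S_F} = exp(ψ̄(-D)ψ)` for `D = staggeredDirac ρ U (-m)`
  (`GrassmannIntegral.lean`, `ρ` the fundamental representation of `U(N)`; generators indexed via `toLex`);
* `chiralLRO_gauge` (any signs `Γ² = 1`), `chiralLRO_gauge_staggered` (the staggered signs) — **Cor. 4.9
  read back at the gauge level** through (2.21): for `1 ≤ N ≤ 4`,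
  `ν ≥ 4`, `|Λ|⁻¹∑_x ⟨(ψ̄ψ(0)/2N)(ψ̄ψ(x)/2N)⟩_Λ ≥ c > 0` at `m = 0` on all large even tori — the
  hypothesis-free complex-spin theorem `ComplexSpin.uN_chiralLRO_of_four_le` of the tree transported.

## Proof sketch (following the paper)

(2.19): `-S_F` is a sum of pairwise commuting, even, nilpotent terms, so `e^{-S_F}` factorises into
`∏_x e^{mψ̄ψ(x)}` times the product over links of the one-link weights (`fermiBoltzmann_eq`); the
`U`-integral of a product of functions of distinct link variables against the product Haar measure
is the product of the one-link integrals (`cintegral_pi_prod_ofFn`), and each one-link integral is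
the Rossi–Wolff polynomial transported from the two-site algebra of `RossiWolffOneLinkIntegral` along
the embedding `ψ̄_a(x), ψ_b(y) ↦` lattice generators (`linkEmbed`, `cintegral_linkWeightAt_staggered`).
(2.20): `(ψ̄ψ(x))^k = k! ∑_{|A|=k} ∏_{a∈A} ψ̄_a(x)ψ_a(x)` (`meson_pow`, nilpotency beyond `N`), so a
meson monomial `∏_x ψ̄ψ(x)^{e_x}` is a combination of pair products over colour sets, whose Berezin
integral vanishes unless every colour at every site occurs, i.e. `e_x = N` for all `x`
(`berezin_coe_prod_mesonC_pow`); linearity gives `berezin_mesonPoly`.  (2.21)–(2.24): substituting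
`σ_x = ψ̄ψ(x)/2N` into `F(σ_x) = ∑_{j≤N}(2Nm)^jσ_x^j/j!` gives `e^{mψ̄ψ(x)}` and into
`B(σ_xσ_y) = ∑_k b_k(σ_xσ_y)^k` gives `B̃(¼ψ̄ψ(x)ψ̄ψ(y))` (`spinObs_siteWeight`, `spinObs_bondWeight`,
the identities `(2Nm)^j(2N)^{-j} = m^j`, `b_k (2N)^{-2k} = b̃_k 4^{-k}`), the substitution is
multiplicative (it lands in the centre of the Grassmann algebra), and (2.20) turns the Berezin
integral into the coefficient of `∏σ_x^N`, i.e. the complex-spin bracket.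

## Scope and faithfulness

* `β = 0`, `g₄ = 0` exactly as in (2.19)–(2.24) for the `U(N)` model (the `g₄ > 0` factor
  `e^{4Ng₄t}` of (2.23) is not included, as in `ComplexSpinInfraredBound`).  The link data are
  general: any finite site set `Λ` with a linear order (fixing the orientation of the Berezin
  integral; all statements are identities whose two sides use the same orientation), any family of
  links with distinct endpoints, any signs `Γ_b` with `Γ_b² = 1` — this covers the staggered phases
  `Γ_μ(x) = ±1` (2.4) with either the antiperiodic ("toroidal", p. 398) or periodic fermion boundary
  condition, all of which give the same bosonised system; on the torus the only hypothesis is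
  `L ≥ 2` (so that `x ≠ x + e_μ`; the complex spin system of the tree lists the bonds `(x, x+e_μ)`
  exactly as the sum `∑_{x,μ}` of (2.21)).
* Expectations (2.10) are `fermiExpect = fermiBracket/fermiZ` with Lean's `x/0 = 0`, matching
  `ComplexSpin.expect`; the identification `fermiExpect_spinObs` holds unconditionally.
* Observables: (2.21) concerns functions of the mesons `ψ̄ψ(x)`; `fermiBracket` is defined for
  general `f(U, ψ̄, ψ)` (2.10) and specialised to `U`-independent `F` in `fermiBracket_const`.
* Nothing here is about `β > 0`, the thermodynamic or continuum limit, `SU(N)`, or the summit's QCD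
  conjunct; Cor. 4.9 enters only through the tree's theorem `ComplexSpin.uN_chiralLRO_of_four_le`.

## Sources

M. Salmhofer, E. Seiler, *Proof of chiral symmetry breaking in strongly coupled lattice gauge
theory*, Commun. Math. Phys. 139 (1991) 395–432: §2, (2.1)–(2.12), (2.16)–(2.24) (pp. 398–401),
Remark 3.2, Remark 3.4(2) (p. 403), Cor. 4.9 [`SalmhoferSeiler1991`]; P. Rossi, U. Wolff, Nucl.
Phys. B 248 (1984) 105 (the one-link integral and (2.20), SS91 ref. [30]) [`RossiWolff1984`];
F. A. Berezin, *The Method of Second Quantization* (1966), Ch. I §3 [`Berezin1966`].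
-/

noncomputable section

namespace Literature.MathematicalPhysics.QuantumLattice

namespace StrongCoupling

open GrassmannAlgebra Matrix

section Indices

variable {Λ : Type*} {N : ℕ}

/-! ### Colour–site indices -/

variable (Λ N) in
/-- Colour–site indices `(x, a)`, `x ∈ Λ`, `a ∈ {1,…,N}`, ordered lexicographically (sites first). [cite: SalmhoferSeiler1991, §2 (2.11)] -/
abbrev CIdx : Type _ := Λ ×ₗ Fin N

/-- The index of colour `a` at site `x`. [cite: SalmhoferSeiler1991, §2 (2.6)] -/
def cidx (x : Λ) (a : Fin N) : CIdx Λ N := toLex (x, a)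

/-- `cidx x` is injective. [cite: SalmhoferSeiler1991, §2 (2.6)] -/
theorem cidx_injective (x : Λ) : Function.Injective (cidx (N := N) x) :=
  fun _ _ h => (Prod.mk.inj (toLex.injective h)).2

/-- `cidx x a = cidx y b ↔ x = y ∧ a = b`. [cite: SalmhoferSeiler1991, §2 (2.6)] -/
@[simp] theorem cidx_inj {x y : Λ} {a b : Fin N} : cidx x a = cidx y b ↔ x = y ∧ a = b := by
  rw [cidx, cidx, toLex.injective.eq_iff, Prod.mk.injEq]

/-- The site of a colour–site index. [cite: SalmhoferSeiler1991, §2 (2.6)] -/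
@[simp] theorem ofLex_cidx_fst (x : Λ) (a : Fin N) : (ofLex (cidx x a)).1 = x := rfl

/-- The colours at the site `x`. [cite: SalmhoferSeiler1991, §2 (2.6)] -/
def colours (x : Λ) : Finset (CIdx Λ N) := Finset.univ.map ⟨cidx x, cidx_injective x⟩

/-- Membership in the colours at `x`. [cite: SalmhoferSeiler1991, §2 (2.6)] -/
@[simp] theorem mem_colours {x : Λ} {i : CIdx Λ N} : i ∈ colours x ↔ (ofLex i).1 = x := by
  constructor
  · intro h
    obtain ⟨a, -, rfl⟩ := Finset.mem_map.1 h
    rfl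
  · intro h
    refine Finset.mem_map.2 ⟨(ofLex i).2, Finset.mem_univ _, ?_⟩
    change toLex (x, (ofLex i).2) = i
    rw [← h]; rfl

/-- There are `N` colours at each site. [cite: SalmhoferSeiler1991, §2 (2.6)] -/
theorem card_colours (x : Λ) : (colours (N := N) x).card = N := by
  rw [colours, Finset.card_map, Finset.card_univ, Fintype.card_fin]

/-- Colours at distinct sites are disjoint. [cite: SalmhoferSeiler1991, §2 (2.6)] -/
theorem disjoint_colours {x y : Λ} (h : x ≠ y) : Disjoint (colours (N := N) x) (colours y) := by
  rw [Finset.disjoint_left]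
  intro i hx hy
  rw [mem_colours] at hx hy
  exact h (hx.symm.trans hy)

/-- The colour sets are pairwise disjoint. [cite: SalmhoferSeiler1991, §2 (2.6)] -/
theorem pairwiseDisjoint_colours (s : Finset Λ) : (s : Set Λ).PairwiseDisjoint (colours (N := N)) :=
  fun _ _ _ _ h => disjoint_colours h

end Indices

section Meson

variable {Λ : Type*} [LinearOrder Λ] {N : ℕ}

/-! ### The fermion algebra of the lattice and the meson fields -/

variable (Λ N) in
/-- The Grassmann algebra `Λ[ψ̄_a(x), ψ_a(x) : x ∈ Λ, a ≤ N]` of the lattice fermions. [cite: SalmhoferSeiler1991, §2 (2.11)] -/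
abbrev FermiAlg : Type _ := GrassmannAlgebra ℂ (CIdx Λ N ⊕ₗ CIdx Λ N)

/-- **The meson field** `ψ̄ψ(x) = ∑_{a=1}^{N} ψ̄_a(x) ψ_a(x)` (Salmhofer–Seiler (2.6)). [cite: SalmhoferSeiler1991, §2 (2.6)] -/
def meson (x : Λ) : FermiAlg Λ N := ∑ a : Fin N, pair (cidx x a) (cidx x a)

/-- `ψ̄ψ(x)` as the sum of the pairs over the colours at `x`. [cite: SalmhoferSeiler1991, §2 (2.6)] -/
theorem meson_eq_sum_colours (x : Λ) : (meson x : FermiAlg Λ N) = ∑ i ∈ colours x, pair i i := by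
  rw [meson, colours, Finset.sum_map]; rfl

/-- The meson field is central. [cite: SalmhoferSeiler1991, §2 (2.6)] -/
theorem commute_meson (x : Λ) (z : FermiAlg Λ N) : Commute (meson x) z :=
  Commute.sum_left _ _ _ fun _ _ => commute_pair _ _ z

/-- **Bosonisation rule**: `(ψ̄ψ(x))^k = k! ∑_{A ⊆ colours(x), |A| = k} ∏_{i∈A} ψ̄_iψ_i`; in particular
`(ψ̄ψ(x))^n = 0` for `n > N`. [cite: SalmhoferSeiler1991, §2 (2.20)] -/
theorem meson_pow (x : Λ) (k : ℕ) :
    (meson x : FermiAlg Λ N) ^ k = (k.factorial : ℂ) • ∑ T ∈ (colours x).powersetCard k, pairProd T := by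
  rw [meson_eq_sum_colours, sum_pair_pow]

/-- `(ψ̄ψ(x))^n = 0` for `n > N` (nilpotency). [cite: SalmhoferSeiler1991, §2 (2.20)] -/
theorem meson_pow_eq_zero (x : Λ) {n : ℕ} (hn : N < n) : (meson x : FermiAlg Λ N) ^ n = 0 := by
  rw [meson_eq_sum_colours, sum_pair_pow_eq_zero]
  rwa [card_colours]

/-- **`e^{m ψ̄ψ(x)} = ∑_{j=0}^{N} m^j (ψ̄ψ(x))^j / j!`** (the series terminates). [cite: SalmhoferSeiler1991, §2 (2.19)–(2.21)] -/
theorem grassmannExp_smul_meson (m : ℂ) (x : Λ) :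
    grassmannExp (m • (meson x : FermiAlg Λ N)) =
      ∑ j ∈ Finset.range (N + 1), (m ^ j / (j.factorial : ℂ)) • meson x ^ j := by
  rw [grassmannExp_eq_sum (k := N + 1) (by rw [smul_pow, meson_pow_eq_zero x (Nat.lt_succ_self N), smul_zero])]
  refine Finset.sum_congr rfl fun j _ => ?_
  rw [smul_pow, smul_smul, div_eq_inv_mul]

/-! ### Polynomials in the meson fields (the centre of the fermion algebra) -/

/-- The rescaled meson field `c · ψ̄ψ(x)` as an element of the centre of the fermion algebra
(`c = 1/(2N)`: Salmhofer–Seiler's spin variable "`σ_x = σ̃/2N`, … `σ̃` replaces `∑_a ψ̄_aψ_a`",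
p. 401). [cite: SalmhoferSeiler1991, §2 (2.20)–(2.21)] -/
def mesonC (c : ℂ) (x : Λ) : Subalgebra.center ℂ (FermiAlg Λ N) :=
  ⟨c • meson x, Subalgebra.mem_center_iff.2 fun z => ((commute_meson x z).smul_left c).eq.symm⟩

/-- The value of `mesonC`. [cite: SalmhoferSeiler1991, §2 (2.20)–(2.21)] -/
@[simp] theorem coe_mesonC (c : ℂ) (x : Λ) : ((mesonC c x : Subalgebra.center ℂ (FermiAlg Λ N)) : FermiAlg Λ N) = c • meson x := rfl

variable (N) in
/-- **Substitution of meson fields into a polynomial**: `Φ ↦ Φ(c ψ̄ψ(x))_{x ∈ Λ}`, the `ℂ`-algebra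
homomorphism `ℂ[σ_x : x ∈ Λ] → centre(Λ[ψ̄, ψ])`, `σ_x ↦ c ψ̄ψ(x)` (Salmhofer–Seiler (2.20)–(2.21): the
observables "`f(ψ̄ψ)`" of the bosonisation). [cite: SalmhoferSeiler1991, §2 (2.20)–(2.21)] -/
def mesonPoly (c : ℂ) : MvPolynomial Λ ℂ →ₐ[ℂ] Subalgebra.center ℂ (FermiAlg Λ N) :=
  MvPolynomial.aeval (mesonC c)

/-- `mesonPoly` on a variable. [cite: SalmhoferSeiler1991, §2 (2.20)–(2.21)] -/
@[simp] theorem mesonPoly_X (c : ℂ) (x : Λ) : mesonPoly N c (MvPolynomial.X x) = mesonC c x :=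
  MvPolynomial.aeval_X _ x

/-- `mesonPoly` on a variable, as an element of the fermion algebra. [cite: SalmhoferSeiler1991, §2 (2.20)–(2.21)] -/
theorem coe_mesonPoly_X (c : ℂ) (x : Λ) : ((mesonPoly N c (MvPolynomial.X x) : Subalgebra.center ℂ (FermiAlg Λ N)) : FermiAlg Λ N) = c • meson x := by
  rw [mesonPoly_X, coe_mesonC]

/-- A pair product as an element of the centre. [cite: SalmhoferSeiler1991, §2 (2.20)] -/
def pairProdC (T : Finset (CIdx Λ N)) : Subalgebra.center ℂ (FermiAlg Λ N) :=
  ⟨pairProd T, Subalgebra.mem_center_iff.2 fun z => (commute_pairProd T z).eq.symm⟩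

/-- The value of `pairProdC`. [cite: SalmhoferSeiler1991, §2 (2.20)] -/
@[simp] theorem coe_pairProdC (T : Finset (CIdx Λ N)) : ((pairProdC T : Subalgebra.center ℂ (FermiAlg Λ N)) : FermiAlg Λ N) = pairProd T := rfl

/-- Powers of the rescaled meson field in the centre. [cite: SalmhoferSeiler1991, §2 (2.20)] -/
theorem mesonC_pow (c : ℂ) (x : Λ) (k : ℕ) :
    (mesonC c x : Subalgebra.center ℂ (FermiAlg Λ N)) ^ k =
      (c ^ k * (k.factorial : ℂ)) • ∑ T ∈ (colours x).powersetCard k, pairProdC T := by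
  apply Subtype.ext
  simp only [SubmonoidClass.coe_pow, coe_mesonC, Subalgebra.coe_smul, AddSubmonoidClass.coe_finsetSum,
    coe_pairProdC, smul_pow, meson_pow, smul_smul]

end Meson

section Lattice

variable {Λ : Type*} [LinearOrder Λ] [Fintype Λ] {N : ℕ}

/-- Every index is a colour at its site: `⋃_x colours x = everything`. [cite: SalmhoferSeiler1991, §2 (2.6)] -/
theorem biUnion_colours : (Finset.univ : Finset Λ).biUnion (colours (N := N)) = Finset.univ := by
  ext i; simp

/-- A product of central pair products is the pair product over the union (for pairwise disjoint
colour sets). [cite: SalmhoferSeiler1991, §2 (2.20)] -/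
theorem coe_prod_pairProdC (T : Λ → Finset (CIdx Λ N)) (hT : ∀ x, T x ⊆ colours x) :
    ((∏ x, pairProdC (T x) : Subalgebra.center ℂ (FermiAlg Λ N)) : FermiAlg Λ N) =
      pairProd (Finset.univ.biUnion T) := by
  have hdisj : ((Finset.univ : Finset Λ) : Set Λ).PairwiseDisjoint T :=
    fun x _ y _ hxy => (disjoint_colours hxy).mono (hT x) (hT y)
  rw [← Finset.disjiUnion_eq_biUnion _ _ hdisj, ← noncommProd_pairProd, ← Finset.noncommProd_eq_prod]
  exact Finset.map_noncommProd Finset.univ (fun x => pairProdC (T x)) _ (Subalgebra.center ℂ (FermiAlg Λ N)).val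

/-- **Monomials in the meson fields**: `∏_x (c ψ̄ψ(x))^{e_x} = (∏_x c^{e_x} e_x!) ∑_{A} ∏_{i ∈ ⋃ A_x} ψ̄_iψ_i`,
the sum over the choices `A_x ⊆ colours(x)`, `|A_x| = e_x`. [cite: SalmhoferSeiler1991, §2 (2.20)] -/
theorem coe_prod_mesonC_pow (c : ℂ) (e : Λ → ℕ) :
    ((∏ x, mesonC c x ^ e x : Subalgebra.center ℂ (FermiAlg Λ N)) : FermiAlg Λ N) =
      (∏ x, c ^ e x * ((e x).factorial : ℂ)) •
        ∑ T ∈ Fintype.piFinset fun x => (colours x).powersetCard (e x), pairProd (Finset.univ.biUnion T) := by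
  simp only [mesonC_pow, Algebra.smul_def, Finset.prod_mul_distrib, ← map_prod]
  rw [Finset.prod_univ_sum, Finset.mul_sum, Finset.mul_sum]
  simp only [AddSubmonoidClass.coe_finsetSum]
  refine Finset.sum_congr rfl fun T hT => ?_
  rw [Subalgebra.coe_mul, coe_prod_pairProdC T fun x => (Finset.mem_powersetCard.1 (Fintype.mem_piFinset.1 hT x)).1,
    Subalgebra.coe_algebraMap, Algebra.algebraMap_eq_smul_one, smul_mul_assoc, one_mul]


/-! ### Bosonisation: the Berezin integral of a polynomial in the meson fields -/

variable (Λ N) in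
/-- The exponent vector `(N, …, N)` of the top meson monomial `∏_x σ_x^N`. [cite: SalmhoferSeiler1991, §2 (2.20)] -/
def topExp : Λ →₀ ℕ := Finsupp.equivFunOnFinite.symm fun _ => N

omit [LinearOrder Λ] in
/-- The top exponent is `N` everywhere. [cite: SalmhoferSeiler1991, §2 (2.20)] -/
@[simp] theorem topExp_apply (x : Λ) : topExp Λ N x = N := rfl

/-- Only the full colour sets cover everything: if `A_x ⊆ colours(x)` for all `x` and
`⋃_x A_x = everything` then `A_x = colours(x)`. [cite: SalmhoferSeiler1991, §2 (2.20)] -/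
theorem eq_colours_of_biUnion_eq_univ {T : Λ → Finset (CIdx Λ N)} (hT : ∀ x, T x ⊆ colours x)
    (hU : Finset.univ.biUnion T = Finset.univ) (x : Λ) : T x = colours x := by
  refine Finset.Subset.antisymm (hT x) fun i hi => ?_
  have hi' : i ∈ Finset.univ.biUnion T := hU ▸ Finset.mem_univ i
  obtain ⟨y, -, hy⟩ := Finset.mem_biUnion.1 hi'
  have hxy : (ofLex i).1 = y := mem_colours.1 (hT y hy)
  rw [mem_colours] at hi
  rw [← hi, hxy]; exact hy

/-- **Berezin integral of a meson monomial**: `∫dψ̄dψ ∏_x (c ψ̄ψ(x))^{e_x} = ε (c^N N!)^{|Λ|} [e ≡ N]`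
(only `∏_x (ψ̄ψ(x))^N` survives: "the rule that `∏_x (ψ̄ψ(x))^N` must appear in each term", p. 404).
[cite: SalmhoferSeiler1991, §2 (2.20)] -/
theorem berezin_coe_prod_mesonC_pow (c : ℂ) (e : Λ → ℕ) :
    berezin ℂ _ (((∏ x, mesonC c x ^ e x : Subalgebra.center ℂ (FermiAlg Λ N))) : FermiAlg Λ N) =
      if ∀ x, e x = N then sgn (Fintype.card (CIdx Λ N)) * (c ^ N * (N.factorial : ℂ)) ^ Fintype.card Λ
      else 0 := by
  rw [coe_prod_mesonC_pow, map_smul, map_sum, smul_eq_mul]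
  split_ifs with he
  · have hpi : (Fintype.piFinset fun x => (colours (N := N) x).powersetCard (e x)) = {colours} := by
      ext T
      simp only [Fintype.mem_piFinset, Finset.mem_singleton, he, funext_iff]
      refine forall_congr' fun x => ⟨fun h => ?_, fun h => ?_⟩
      · obtain ⟨hsub, hcard⟩ := Finset.mem_powersetCard.1 h
        exact Finset.eq_of_subset_of_card_le hsub (by rw [card_colours, hcard])
      · rw [h, Finset.mem_powersetCard]
        exact ⟨Finset.Subset.refl _, card_colours x⟩
    rw [hpi, Finset.sum_singleton, biUnion_colours, berezin_pairProd_univ, mul_comm, Finset.prod_congr rfl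
      fun x _ => by rw [he x], Finset.prod_const, Finset.card_univ]
  · obtain ⟨x₀, hx₀⟩ := not_forall.1 he
    rw [Finset.sum_eq_zero, mul_zero]
    intro T hT
    have hT' : ∀ x, T x ∈ (colours x).powersetCard (e x) := fun x => Fintype.mem_piFinset.1 hT x
    rw [berezin_pairProd, if_neg]
    intro hU
    apply hx₀
    have h1 := eq_colours_of_biUnion_eq_univ (fun x => (Finset.mem_powersetCard.1 (hT' x)).1) hU x₀
    rw [← (Finset.mem_powersetCard.1 (hT' x₀)).2, h1, card_colours]

/-- `mesonPoly` on a monomial. [cite: SalmhoferSeiler1991, §2 (2.20)] -/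
theorem coe_mesonPoly_monomial (c : ℂ) (e : Λ →₀ ℕ) (a : ℂ) :
    ((mesonPoly N c (MvPolynomial.monomial e a) : Subalgebra.center ℂ (FermiAlg Λ N)) : FermiAlg Λ N) =
      a • (((∏ x, mesonC c x ^ e x : Subalgebra.center ℂ (FermiAlg Λ N))) : FermiAlg Λ N) := by
  rw [mesonPoly, MvPolynomial.aeval_monomial, Finsupp.prod_fintype _ _ fun x => pow_zero _, Subalgebra.coe_mul,
    Subalgebra.coe_algebraMap, Algebra.smul_def]

/-- **Bosonisation (Salmhofer–Seiler (2.20), all sites at once).**  For every polynomial `Φ` in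
commuting variables `σ_x`, `x ∈ Λ`, the Berezin integral of `Φ(c ψ̄ψ)` over all `ψ̄_a(x), ψ_a(x)` is
`ε (c^N N!)^{|Λ|}` times the coefficient of `∏_x σ_x^N` in `Φ` — the printed one-site rule
`∫dψdψ̄ f(ψ̄ψ) = N! ∮ dσ̃/(2πiσ̃) σ̃^{-N} f(σ̃)` (coefficient extraction) applied at every site, with the
global orientation sign `ε = (-1)^{n(n-1)/2}`, `n = N|Λ|`, of the tree's Berezin integral
(`berezin (ψ̄_1⋯ψ̄_n ψ_1⋯ψ_n) = 1`; the paper's `∏ dψ_a dψ̄_a` ordering has `ε = 1`). [cite: SalmhoferSeiler1991, §2 (2.20)] -/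
theorem berezin_mesonPoly (c : ℂ) (Φ : MvPolynomial Λ ℂ) :
    berezin ℂ _ ((mesonPoly N c Φ : Subalgebra.center ℂ (FermiAlg Λ N)) : FermiAlg Λ N) =
      sgn (Fintype.card (CIdx Λ N)) * (c ^ N * (N.factorial : ℂ)) ^ Fintype.card Λ *
        MvPolynomial.coeff (topExp Λ N) Φ := by
  conv_lhs => rw [Φ.as_sum, map_sum, AddSubmonoidClass.coe_finsetSum, map_sum]
  simp only [coe_mesonPoly_monomial, map_smul, berezin_coe_prod_mesonC_pow, smul_eq_mul, mul_ite, mul_zero]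
  have hiff : ∀ e : Λ →₀ ℕ, (∀ x, e x = N) ↔ e = topExp Λ N := fun e =>
    ⟨fun h => Finsupp.ext fun x => by rw [h x, topExp_apply], fun h x => by rw [h, topExp_apply]⟩
  simp only [hiff, Finset.sum_ite_eq', MvPolynomial.mem_support_iff, ne_eq, ite_not]
  split_ifs with h0
  · rw [h0, mul_zero]
  · ring

/-! ### Hopping terms and the transport of the one-link integral to the lattice -/

/-- The hopping term `ψ̄(x) V ψ(y) = ∑_{a,c} V_{ac} ψ̄_a(x) ψ_c(y)` of the link `(x, y)` (Salmhofer–Seiler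
(2.3): `ψ̄(x)U_μ(x)ψ(x+e_μ)` and, with `V = U†`, `ψ̄(x+e_μ)U_μ(x)⁻¹ψ(x)`). [cite: SalmhoferSeiler1991, §2 (2.3)] -/
def hopAt (x y : Λ) (V : Matrix (Fin N) (Fin N) ℂ) : FermiAlg Λ N :=
  ∑ a, ∑ c, V a c • pair (cidx x a) (cidx y c)

/-- The Boltzmann weight `exp(s ψ̄(x)Vψ(y)) exp(s' ψ̄(y)V†ψ(x))` of one link on the lattice. [cite: SalmhoferSeiler1991, §2 (2.3), (2.16)] -/
def linkWeightAt (x y : Λ) (s s' : ℂ) (V : Matrix (Fin N) (Fin N) ℂ) : FermiAlg Λ N :=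
  grassmannExp (s • hopAt x y V) * grassmannExp (s' • hopAt y x Vᴴ)

/-- **The bond weight `B̃(¼ ψ̄ψ(x) ψ̄ψ(y)) = ∑_{k=0}^{N} (N-k)!/(N! k!) (¼ ψ̄ψ(x)ψ̄ψ(y))^k`** of the
effective fermionic action at `β = 0` (Salmhofer–Seiler (2.16)–(2.17), (2.19)). [cite: SalmhoferSeiler1991, §2 (2.16)–(2.19)] -/
def bondFactor (x y : Λ) : FermiAlg Λ N :=
  ∑ k ∈ Finset.range (N + 1), (((N - k).factorial : ℂ) / ((N.factorial : ℂ) * (k.factorial : ℂ))) •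
    ((1 / 4 : ℂ) • (meson x * meson y)) ^ k

/-- The colour index map of the link `(x, y)`: the two-site colours `xc a`, `yc c` of
`RossiWolffOneLinkIntegral` go to `(x, a)`, `(y, c)`. [cite: SalmhoferSeiler1991, §2 (2.16)] -/
def linkIdx (x y : Λ) (i : OneLink.TwoSite N) : CIdx Λ N := Sum.elim (cidx x) (cidx y) (finSumFinEquiv.symm i)

omit [LinearOrder Λ] [Fintype Λ] in
/-- `linkIdx` on an `x`-colour. [cite: SalmhoferSeiler1991, §2 (2.16)] -/
@[simp] theorem linkIdx_xc (x y : Λ) (a : Fin N) : linkIdx x y (OneLink.xc a) = cidx x a := by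
  rw [linkIdx, OneLink.xc, Equiv.symm_apply_apply]; rfl

omit [LinearOrder Λ] [Fintype Λ] in
/-- `linkIdx` on a `y`-colour. [cite: SalmhoferSeiler1991, §2 (2.16)] -/
@[simp] theorem linkIdx_yc (x y : Λ) (c : Fin N) : linkIdx x y (OneLink.yc c) = cidx y c := by
  rw [linkIdx, OneLink.yc, Equiv.symm_apply_apply]; rfl

omit [LinearOrder Λ] [Fintype Λ] in
/-- For `x ≠ y` the colour index map of the link is injective. [cite: SalmhoferSeiler1991, §2 (2.16)] -/
theorem linkIdx_injective {x y : Λ} (hxy : x ≠ y) : Function.Injective (linkIdx (N := N) x y) := by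
  intro i j h
  rcases OneLink.xc_or_yc i with ⟨a, rfl⟩ | ⟨a, rfl⟩ <;> rcases OneLink.xc_or_yc j with ⟨c, rfl⟩ | ⟨c, rfl⟩ <;>
    simp only [linkIdx_xc, linkIdx_yc, cidx_inj] at h
  · rw [h.2]
  · exact absurd h.1 hxy
  · exact absurd h.1.symm hxy
  · rw [h.2]

/-- The generator index map of the link (same map on `ψ̄`- and `ψ`-indices). [cite: SalmhoferSeiler1991, §2 (2.16)] -/
def linkGenIdx (x y : Λ) (w : OneLink.TwoSite N ⊕ₗ OneLink.TwoSite N) : CIdx Λ N ⊕ₗ CIdx Λ N :=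
  toLex (Sum.map (linkIdx x y) (linkIdx x y) (ofLex w))

omit [LinearOrder Λ] [Fintype Λ] in
/-- `linkGenIdx` on a `ψ̄`-index. [cite: SalmhoferSeiler1991, §2 (2.16)] -/
@[simp] theorem linkGenIdx_barIdx (x y : Λ) (i : OneLink.TwoSite N) :
    linkGenIdx x y (barIdx i) = barIdx (linkIdx x y i) := rfl

omit [LinearOrder Λ] [Fintype Λ] in
/-- `linkGenIdx` on a `ψ`-index. [cite: SalmhoferSeiler1991, §2 (2.16)] -/
@[simp] theorem linkGenIdx_psiIdx (x y : Λ) (i : OneLink.TwoSite N) :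
    linkGenIdx x y (psiIdx i) = psiIdx (linkIdx x y i) := rfl

omit [LinearOrder Λ] [Fintype Λ] in
/-- For `x ≠ y` the generator index map is injective. [cite: SalmhoferSeiler1991, §2 (2.16)] -/
theorem linkGenIdx_injective {x y : Λ} (hxy : x ≠ y) : Function.Injective (linkGenIdx (N := N) x y) :=
  fun w w' h => toLex.injective (by
    have := toLex.injective h
    exact (Sum.map_injective.2 ⟨linkIdx_injective hxy, linkIdx_injective hxy⟩) this) |> fun h' =>
      ofLex.injective h'

/-- **The embedding of the one-link Grassmann algebra into the lattice algebra** along the link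
`(x, y)`: the algebra homomorphism induced by extension by zero along `linkGenIdx`. [cite: SalmhoferSeiler1991, §2 (2.16)] -/
def linkEmbed (x y : Λ) : OneLink.Alg N →ₐ[ℂ] FermiAlg Λ N :=
  ExteriorAlgebra.map (Function.ExtendByZero.linearMap ℂ (linkGenIdx x y))

/-- Extension by zero along an injection maps basis vectors to basis vectors. [cite: SalmhoferSeiler1991, §2 (2.16)] -/
theorem extendByZero_single_of_injective {κ J : Type*} [DecidableEq κ] [DecidableEq J] {f : κ → J}
    (hf : Function.Injective f) (i : κ) :
    Function.ExtendByZero.linearMap ℂ f (Pi.single i 1) = Pi.single (f i) 1 := by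
  ext j
  change Function.extend f (Pi.single i (1 : ℂ)) 0 j = (Pi.single (f i) (1 : ℂ) : J → ℂ) j
  by_cases hj : ∃ k, f k = j
  · obtain ⟨k, rfl⟩ := hj
    rw [hf.extend_apply]
    by_cases hki : k = i
    · subst hki; rw [Pi.single_eq_same, Pi.single_eq_same]
    · rw [Pi.single_eq_of_ne hki, Pi.single_eq_of_ne (fun h => hki (hf h))]
  · rw [Function.extend_apply' _ _ _ hj, Pi.zero_apply, Pi.single_eq_of_ne]
    rintro rfl
    exact hj ⟨i, rfl⟩

omit [Fintype Λ] in
/-- The link embedding on generators (`x ≠ y`). [cite: SalmhoferSeiler1991, §2 (2.16)] -/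
theorem linkEmbed_gen {x y : Λ} (hxy : x ≠ y) (w : OneLink.TwoSite N ⊕ₗ OneLink.TwoSite N) :
    linkEmbed x y (gen ℂ w) = gen ℂ (linkGenIdx x y w) := by
  rw [linkEmbed, gen, ExteriorAlgebra.map_apply_ι, extendByZero_single_of_injective (linkGenIdx_injective hxy), gen]

omit [Fintype Λ] in
/-- The link embedding on `ψ̄_i`. [cite: SalmhoferSeiler1991, §2 (2.16)] -/
theorem linkEmbed_psiBar {x y : Λ} (hxy : x ≠ y) (i : OneLink.TwoSite N) :
    linkEmbed x y (psiBar ℂ i) = psiBar ℂ (linkIdx x y i) := by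
  rw [psiBar, linkEmbed_gen hxy, linkGenIdx_barIdx, psiBar]

omit [Fintype Λ] in
/-- The link embedding on `ψ_i`. [cite: SalmhoferSeiler1991, §2 (2.16)] -/
theorem linkEmbed_psi {x y : Λ} (hxy : x ≠ y) (i : OneLink.TwoSite N) :
    linkEmbed x y (psi ℂ i) = psi ℂ (linkIdx x y i) := by
  rw [psi, linkEmbed_gen hxy, linkGenIdx_psiIdx, psi]

omit [Fintype Λ] in
/-- The link embedding on pairs. [cite: SalmhoferSeiler1991, §2 (2.16)] -/
theorem linkEmbed_pair {x y : Λ} (hxy : x ≠ y) (i j : OneLink.TwoSite N) :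
    linkEmbed x y (pair i j) = pair (linkIdx x y i) (linkIdx x y j) := by
  rw [map_mul, linkEmbed_psiBar hxy, linkEmbed_psi hxy]

omit [Fintype Λ] in
/-- The link embedding on the hopping term: `ψ̄(x)Vψ(y)`. [cite: SalmhoferSeiler1991, §2 (2.3)] -/
theorem linkEmbed_hop {x y : Λ} (hxy : x ≠ y) (V : Matrix (Fin N) (Fin N) ℂ) :
    linkEmbed x y (OneLink.hop V) = hopAt x y V := by
  simp only [OneLink.hop_eq, map_sum, map_smul, linkEmbed_pair hxy, linkIdx_xc, linkIdx_yc, hopAt]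

omit [Fintype Λ] in
/-- The link embedding on the reversed hopping term: `ψ̄(y)V†ψ(x)`. [cite: SalmhoferSeiler1991, §2 (2.3)] -/
theorem linkEmbed_hopBack {x y : Λ} (hxy : x ≠ y) (V : Matrix (Fin N) (Fin N) ℂ) :
    linkEmbed x y (OneLink.hopBack V) = hopAt y x Vᴴ := by
  simp only [OneLink.hopBack_eq, map_sum, map_smul, linkEmbed_pair hxy, linkIdx_xc, linkIdx_yc, hopAt,
    Matrix.conjTranspose_apply]

omit [Fintype Λ] in
/-- The link embedding on `ψ̄ψ(x)`. [cite: SalmhoferSeiler1991, §2 (2.6)] -/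
theorem linkEmbed_mesonX {x y : Λ} (hxy : x ≠ y) : linkEmbed x y (OneLink.mesonX : OneLink.Alg N) = meson x := by
  simp only [OneLink.mesonX_eq, map_sum, linkEmbed_pair hxy, linkIdx_xc, meson]

omit [Fintype Λ] in
/-- The link embedding on `ψ̄ψ(y)`. [cite: SalmhoferSeiler1991, §2 (2.6)] -/
theorem linkEmbed_mesonY {x y : Λ} (hxy : x ≠ y) : linkEmbed x y (OneLink.mesonY : OneLink.Alg N) = meson y := by
  simp only [OneLink.mesonY_eq, map_sum, linkEmbed_pair hxy, linkIdx_yc, meson]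

omit [LinearOrder Λ] in
/-- The link embedding commutes with exponentials. [cite: SalmhoferSeiler1991, §2 (2.16)] -/
theorem linkEmbed_grassmannExp (x y : Λ) (a : OneLink.Alg N) :
    linkEmbed x y (grassmannExp a) = grassmannExp (linkEmbed x y a) := map_grassmannExp_eq ℂ _ a

/-- The link embedding on the one-link Boltzmann weight. [cite: SalmhoferSeiler1991, §2 (2.16)] -/
theorem linkEmbed_linkWeight {x y : Λ} (hxy : x ≠ y) (s s' : ℂ) (V : Matrix (Fin N) (Fin N) ℂ) :
    linkEmbed x y (OneLink.linkWeight s s' V) = linkWeightAt x y s s' V := by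
  rw [OneLink.linkWeight, map_mul, linkEmbed_grassmannExp, linkEmbed_grassmannExp, map_smul, map_smul,
    linkEmbed_hop hxy, linkEmbed_hopBack hxy, linkWeightAt]

open Literature.MathematicalPhysics.QuantumFieldTheory (haarProbability) in
/-- **The one-link integral on the lattice**: `∫ dU exp(s ψ̄(x)Uψ(y)) exp(s' ψ̄(y)U†ψ(x))` is the image
of the one-link integral of `RossiWolffOneLinkIntegral`. [cite: SalmhoferSeiler1991, §2 (2.16)] -/
theorem cintegral_linkWeightAt {x y : Λ} (hxy : x ≠ y) (s s' : ℂ) :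
    cintegral (haarProbability (OneLink.UN N)) (fun U => linkWeightAt x y s s' (U : Matrix (Fin N) (Fin N) ℂ)) =
      linkEmbed x y (OneLink.oneLinkIntegral s s') := by
  rw [OneLink.oneLinkIntegral, show linkEmbed x y _ = _ from
    map_cintegral (linkEmbed x y).toLinearMap (OneLink.coeffIntegrable_linkWeight s s')]
  exact cintegral_congr fun U => (linkEmbed_linkWeight hxy s s' _).symm

open Literature.MathematicalPhysics.QuantumFieldTheory (haarProbability) in
/-- **The one-link integral of the staggered action on the lattice (Salmhofer–Seiler (2.16)–(2.17))**:
for a sign `Γ` with `Γ² = 1`,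
`∫ dU e^{-½Γ ψ̄(x)Uψ(y)} e^{½Γ ψ̄(y)U†ψ(x)} = B̃(¼ ψ̄ψ(x)ψ̄ψ(y))`. [cite: SalmhoferSeiler1991, §2 (2.16)–(2.17)] -/
theorem cintegral_linkWeightAt_staggered {x y : Λ} (hxy : x ≠ y) (Γ : ℂ) (hΓ : Γ ^ 2 = 1) :
    cintegral (haarProbability (OneLink.UN N))
        (fun U => linkWeightAt x y (-(Γ / 2)) (Γ / 2) (U : Matrix (Fin N) (Fin N) ℂ)) = bondFactor x y := by
  rw [cintegral_linkWeightAt hxy, OneLink.oneLinkIntegral_staggered Γ hΓ, map_sum, bondFactor]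
  refine Finset.sum_congr rfl fun k _ => ?_
  rw [map_smul, map_pow, map_smul, map_mul, linkEmbed_mesonX hxy, linkEmbed_mesonY hxy]

/-! ### Even nilpotent elements: exponentials of sums factorise -/

omit [Fintype Λ] in
/-- Pairs are even. [cite: Berezin1966, Ch. I §3 (3.1)] -/
theorem pair_mem_evenOdd_zero (i j : CIdx Λ N) : (pair i j : FermiAlg Λ N) ∈ evenOdd ℂ (ι := CIdx Λ N ⊕ₗ CIdx Λ N) 0 :=
  psiBar_mul_psi_mem_evenOdd_zero ℂ i j

omit [Fintype Λ] in
/-- The meson field is even. [cite: SalmhoferSeiler1991, §2 (2.6)] -/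
theorem smul_meson_mem_evenOdd_zero (m : ℂ) (x : Λ) :
    m • (meson x : FermiAlg Λ N) ∈ evenOdd ℂ (ι := CIdx Λ N ⊕ₗ CIdx Λ N) 0 :=
  Submodule.smul_mem _ m (Submodule.sum_mem _ fun _ _ => pair_mem_evenOdd_zero _ _)

omit [Fintype Λ] in
/-- `m ψ̄ψ(x)` is nilpotent. [cite: SalmhoferSeiler1991, §2 (2.20)] -/
theorem isNilpotent_smul_meson (m : ℂ) (x : Λ) : IsNilpotent (m • (meson x : FermiAlg Λ N)) :=
  ⟨N + 1, by rw [smul_pow, meson_pow_eq_zero x (Nat.lt_succ_self N), smul_zero]⟩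

omit [Fintype Λ] in
/-- `exp(m ψ̄ψ(x))` is central. [cite: SalmhoferSeiler1991, §2 (2.19)] -/
theorem commute_grassmannExp_smul_meson (m : ℂ) (x : Λ) (z : FermiAlg Λ N) :
    Commute (grassmannExp (m • meson x)) z :=
  commute_of_mem_evenOdd_zero ℂ
    (grassmannExp_mem_evenOdd_zero ℂ (smul_meson_mem_evenOdd_zero m x) (isNilpotent_smul_meson m x)) z

omit [Fintype Λ] in
/-- Hopping terms are even. [cite: SalmhoferSeiler1991, §2 (2.3)] -/
theorem smul_hopAt_mem_evenOdd_zero (c : ℂ) (x y : Λ) (V : Matrix (Fin N) (Fin N) ℂ) :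
    c • hopAt x y V ∈ evenOdd ℂ (ι := CIdx Λ N ⊕ₗ CIdx Λ N) 0 :=
  Submodule.smul_mem _ c (Submodule.sum_mem _ fun _ _ => Submodule.sum_mem _ fun _ _ =>
    Submodule.smul_mem _ _ (pair_mem_evenOdd_zero _ _))

omit [Fintype Λ] in
/-- Hopping terms have no constant part. [cite: SalmhoferSeiler1991, §2 (2.3)] -/
theorem constPart_hopAt (x y : Λ) (V : Matrix (Fin N) (Fin N) ℂ) : constPart ℂ (hopAt x y V) = 0 := by
  simp [hopAt, psiBar, psi]

/-- Hopping terms are nilpotent. [cite: SalmhoferSeiler1991, §2 (2.3)] -/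
theorem isNilpotent_smul_hopAt (c : ℂ) (x y : Λ) (V : Matrix (Fin N) (Fin N) ℂ) : IsNilpotent (c • hopAt x y V) :=
  ⟨_, pow_card_succ_eq_zero_of_constPart_eq_zero ℂ (by rw [map_smul, constPart_hopAt, smul_zero])⟩

omit [LinearOrder Λ] [Fintype Λ] in
/-- **`exp` of a sum of even nilpotent elements is the product of the exponentials.** [cite: Berezin1966, Ch. I §3] -/
theorem grassmannExp_sum_of_mem_evenOdd_zero {α : Type*} [DecidableEq α] (s : Finset α) (f : α → FermiAlg Λ N)
    (hf : ∀ i, f i ∈ evenOdd ℂ (ι := CIdx Λ N ⊕ₗ CIdx Λ N) 0) (hn : ∀ i, IsNilpotent (f i)) :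
    grassmannExp (∑ i ∈ s, f i) = s.noncommProd (fun i => grassmannExp (f i))
      (fun i _ _ _ _ => commute_of_mem_evenOdd_zero ℂ (grassmannExp_mem_evenOdd_zero ℂ (hf i) (hn i)) _) := by
  induction s using Finset.induction_on with
  | empty => simp [grassmannExp, IsNilpotent.exp_zero]
  | insert a s ha ih =>
    rw [Finset.sum_insert ha, Finset.noncommProd_insert_of_notMem _ _ _ _ ha, ← ih, grassmannExp, grassmannExp,
      grassmannExp, IsNilpotent.exp_add_of_commute
        (Commute.sum_right _ _ _ fun j _ => commute_of_mem_evenOdd_zero ℂ (hf a) _) (hn a)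
        (Commute.isNilpotent_sum (fun j _ => hn j) fun i j _ _ => commute_of_mem_evenOdd_zero ℂ (hf i) _)]

omit [LinearOrder Λ] [Fintype Λ] in
/-- The sum of two even nilpotent elements exponentiates to the product. [cite: Berezin1966, Ch. I §3] -/
theorem grassmannExp_add_of_mem_evenOdd_zero {a b : FermiAlg Λ N}
    (ha : a ∈ evenOdd ℂ (ι := CIdx Λ N ⊕ₗ CIdx Λ N) 0) (hna : IsNilpotent a) (hnb : IsNilpotent b) :
    grassmannExp (a + b) = grassmannExp a * grassmannExp b :=
  IsNilpotent.exp_add_of_commute (commute_of_mem_evenOdd_zero ℂ ha b) hna hnb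

/-- The link weight as one exponential. [cite: SalmhoferSeiler1991, §2 (2.3)] -/
theorem linkWeightAt_eq (x y : Λ) (s s' : ℂ) (V : Matrix (Fin N) (Fin N) ℂ) :
    linkWeightAt x y s s' V = grassmannExp (s • hopAt x y V + s' • hopAt y x Vᴴ) := by
  rw [linkWeightAt, grassmannExp_add_of_mem_evenOdd_zero (smul_hopAt_mem_evenOdd_zero s x y V)
    (isNilpotent_smul_hopAt s x y V) (isNilpotent_smul_hopAt s' y x Vᴴ)]

omit [LinearOrder Λ] [Fintype Λ] in
/-- A sum of even elements is even. [cite: Berezin1966, Ch. I §3] -/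
theorem sum_mem_evenOdd_zero {α : Type*} (s : Finset α) {f : α → FermiAlg Λ N}
    (hf : ∀ i, f i ∈ evenOdd ℂ (ι := CIdx Λ N ⊕ₗ CIdx Λ N) 0) :
    ∑ i ∈ s, f i ∈ evenOdd ℂ (ι := CIdx Λ N ⊕ₗ CIdx Λ N) 0 :=
  Submodule.sum_mem _ fun i _ => hf i

omit [LinearOrder Λ] [Fintype Λ] in
/-- A sum of pairwise commuting (even) nilpotent elements is nilpotent. [cite: Berezin1966, Ch. I §3] -/
theorem isNilpotent_sum_of_mem_evenOdd_zero {α : Type*} (s : Finset α) {f : α → FermiAlg Λ N}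
    (hf : ∀ i, f i ∈ evenOdd ℂ (ι := CIdx Λ N ⊕ₗ CIdx Λ N) 0) (hn : ∀ i, IsNilpotent (f i)) :
    IsNilpotent (∑ i ∈ s, f i) :=
  Commute.isNilpotent_sum (fun j _ => hn j) fun i _ _ _ => commute_of_mem_evenOdd_zero ℂ (hf i) _

/-- The link weight is even. [cite: SalmhoferSeiler1991, §2 (2.3)] -/
theorem linkWeightAt_mem_evenOdd_zero (x y : Λ) (s s' : ℂ) (V : Matrix (Fin N) (Fin N) ℂ) :
    linkWeightAt x y s s' V ∈ evenOdd ℂ (ι := CIdx Λ N ⊕ₗ CIdx Λ N) 0 :=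
  mul_mem_evenOdd_zero ℂ
    (grassmannExp_mem_evenOdd_zero ℂ (smul_hopAt_mem_evenOdd_zero s x y V) (isNilpotent_smul_hopAt s x y V))
    (grassmannExp_mem_evenOdd_zero ℂ (smul_hopAt_mem_evenOdd_zero s' y x Vᴴ) (isNilpotent_smul_hopAt s' y x Vᴴ))

/-- The link weight is central. [cite: SalmhoferSeiler1991, §2 (2.3)] -/
theorem commute_linkWeightAt (x y : Λ) (s s' : ℂ) (V : Matrix (Fin N) (Fin N) ℂ) (z : FermiAlg Λ N) :
    Commute (linkWeightAt x y s s' V) z :=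
  commute_of_mem_evenOdd_zero ℂ (linkWeightAt_mem_evenOdd_zero x y s s' V) z

omit [Fintype Λ] in
/-- The bond weight is central. [cite: SalmhoferSeiler1991, §2 (2.19)] -/
theorem commute_bondFactor (x y : Λ) (z : FermiAlg Λ N) : Commute (bondFactor x y) z :=
  Commute.sum_left _ _ _ fun k _ =>
    Commute.smul_left (Commute.pow_left (Commute.smul_left ((commute_meson x z).mul_left (commute_meson y z)) _) k) _

/-! ### The staggered fermion action at `β = 0` and its gauge average (Salmhofer–Seiler (2.3), (2.9)–(2.12), (2.19)) -/

section Gauge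

open _root_.MeasureTheory
open Literature.MathematicalPhysics.QuantumFieldTheory (haarProbability)

variable {B : Type*} [Fintype B] [DecidableEq B]

/-- **Minus the staggered fermion action**, `-S_F` of Salmhofer–Seiler (2.3) at `β = 0`, for links
`b ↦ (x_b, y_b) = l b` carrying gauge variables `U_b ∈ U(N)` and signs `Γ_b` (the paper:
`l (x, μ) = (x, x + e_μ)`, `Γ = Γ_μ(x) = ±1` of (2.4), times the antiperiodic boundary sign), mass `m`:
`-S_F = ∑_x m ψ̄ψ(x) - ½ ∑_b Γ_b (ψ̄(x_b) U_b ψ(y_b) - ψ̄(y_b) U_b⁻¹ ψ(x_b))`, `U_b⁻¹ = U_b†`. [cite: SalmhoferSeiler1991, §2 (2.3)] -/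
def negAction (l : B → Λ × Λ) (Γ : B → ℂ) (m : ℂ) (U : B → OneLink.UN N) : FermiAlg Λ N :=
  ∑ x, m • meson x +
    ∑ b, (-(Γ b / 2) • hopAt (l b).1 (l b).2 (U b : Matrix (Fin N) (Fin N) ℂ) +
      (Γ b / 2) • hopAt (l b).2 (l b).1 (U b : Matrix (Fin N) (Fin N) ℂ)ᴴ)

/-- **The fermionic Boltzmann weight `e^{-S_F}`** at `β = 0` (and `g₄ = 0`) as a function of the gauge
field (the integrand of (2.9) after dropping `βS_g`). [cite: SalmhoferSeiler1991, §2 (2.2)–(2.3), (2.9)] -/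
def fermiBoltzmann (l : B → Λ × Λ) (Γ : B → ℂ) (m : ℂ) (U : B → OneLink.UN N) : FermiAlg Λ N :=
  grassmannExp (negAction l Γ m U)

/-- **Factorisation of `e^{-S_F}`** into commuting site and link factors:
`e^{-S_F} = ∏_x e^{m ψ̄ψ(x)} · ∏_b e^{-½Γ_b ψ̄(x_b)U_bψ(y_b)} e^{½Γ_b ψ̄(y_b)U_b†ψ(x_b)}`. [cite: SalmhoferSeiler1991, §2 (2.3), (2.16)] -/
theorem fermiBoltzmann_eq (l : B → Λ × Λ) (Γ : B → ℂ) (m : ℂ) (U : B → OneLink.UN N) :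
    fermiBoltzmann l Γ m U =
      Finset.univ.noncommProd (fun x => grassmannExp (m • (meson x : FermiAlg Λ N)))
          (fun x _ _ _ _ => commute_grassmannExp_smul_meson m x _) *
        Finset.univ.noncommProd
          (fun b => linkWeightAt (l b).1 (l b).2 (-(Γ b / 2)) (Γ b / 2) (U b : Matrix (Fin N) (Fin N) ℂ))
          (fun _ _ _ _ _ => commute_linkWeightAt _ _ _ _ _ _) := by
  have h1 : ∀ x, m • (meson x : FermiAlg Λ N) ∈ evenOdd ℂ (ι := CIdx Λ N ⊕ₗ CIdx Λ N) 0 :=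
    fun x => smul_meson_mem_evenOdd_zero m x
  have h2 : ∀ b, (-(Γ b / 2) • hopAt (l b).1 (l b).2 (U b : Matrix (Fin N) (Fin N) ℂ) +
      (Γ b / 2) • hopAt (l b).2 (l b).1 (U b : Matrix (Fin N) (Fin N) ℂ)ᴴ) ∈ evenOdd ℂ (ι := CIdx Λ N ⊕ₗ CIdx Λ N) 0 :=
    fun b => Submodule.add_mem _ (smul_hopAt_mem_evenOdd_zero _ _ _ _) (smul_hopAt_mem_evenOdd_zero _ _ _ _)
  have hn2 : ∀ b, IsNilpotent (-(Γ b / 2) • hopAt (l b).1 (l b).2 (U b : Matrix (Fin N) (Fin N) ℂ) +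
      (Γ b / 2) • hopAt (l b).2 (l b).1 (U b : Matrix (Fin N) (Fin N) ℂ)ᴴ) :=
    fun b => Commute.isNilpotent_add (commute_of_mem_evenOdd_zero ℂ (smul_hopAt_mem_evenOdd_zero _ _ _ _) _)
      (isNilpotent_smul_hopAt _ _ _ _) (isNilpotent_smul_hopAt _ _ _ _)
  rw [fermiBoltzmann, negAction, grassmannExp_add_of_mem_evenOdd_zero (sum_mem_evenOdd_zero _ h1)
      (isNilpotent_sum_of_mem_evenOdd_zero _ h1 fun x => isNilpotent_smul_meson m x)
      (isNilpotent_sum_of_mem_evenOdd_zero _ h2 hn2),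
    grassmannExp_sum_of_mem_evenOdd_zero _ _ h1 fun x => isNilpotent_smul_meson m x,
    grassmannExp_sum_of_mem_evenOdd_zero _ _ h2 hn2]
  congr 1
  exact Finset.noncommProd_congr rfl (fun b _ => (linkWeightAt_eq _ _ _ _ _).symm) _

variable (N B) in
/-- The gauge measure `𝒟_Λ U = ∏_b dU_b`, `dU` the Haar probability measure on `U(N)` (2.12). [cite: SalmhoferSeiler1991, §2 (2.12)] -/
def gaugeMeasure : Measure (B → OneLink.UN N) := Measure.pi fun _ => haarProbability (OneLink.UN N)

/-- **The gauge average `∫ 𝒟U e^{-S_F}` of the fermionic Boltzmann weight at `β = 0`** — the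
effective fermionic Boltzmann weight of (2.19) (an element of the Grassmann algebra; the
coefficientwise `U`-integral `GrassmannAlgebra.cintegral`). [cite: SalmhoferSeiler1991, §2 (2.9), (2.19)] -/
def gaugeAverage (l : B → Λ × Λ) (Γ : B → ℂ) (m : ℂ) : FermiAlg Λ N :=
  cintegral (gaugeMeasure N B) (fermiBoltzmann l Γ m)

end Gauge

/-! ### Coefficientwise continuity under linear maps and finite products -/

/-- Coefficientwise continuity is preserved by linear maps of Grassmann algebras. [cite: SalmhoferSeiler1991, §2 (2.12)] -/
theorem _root_.Literature.MathematicalPhysics.QuantumLattice.GrassmannAlgebra.CoeffContinuous.linearMap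
    {κ κ' : Type*} [LinearOrder κ] [Fintype κ] [LinearOrder κ'] [Fintype κ'] {Ω : Type*} [TopologicalSpace Ω]
    {F : Ω → GrassmannAlgebra ℂ κ} (hF : CoeffContinuous F) (φ : GrassmannAlgebra ℂ κ →ₗ[ℂ] GrassmannAlgebra ℂ κ') :
    CoeffContinuous fun ω => φ (F ω) := by
  intro s
  have h : (fun ω => coord s (φ (F ω))) = fun ω => ∑ t, coord t (F ω) * coord s (φ (grassmannBasis ℂ κ t)) := by
    funext ω
    conv_lhs => rw [eq_sum_coord_smul (F ω)]
    simp only [map_sum, map_smul, coord_sum, coord_smul]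
  rw [h]
  exact continuous_finsetSum _ fun t _ => (hF t).mul continuous_const

/-- Coefficientwise continuity is preserved by composition with a continuous map. [cite: SalmhoferSeiler1991, §2 (2.12)] -/
theorem _root_.Literature.MathematicalPhysics.QuantumLattice.GrassmannAlgebra.CoeffContinuous.comp
    {κ : Type*} [LinearOrder κ] [Fintype κ] {Ω Ω' : Type*} [TopologicalSpace Ω] [TopologicalSpace Ω']
    {F : Ω → GrassmannAlgebra ℂ κ} (hF : CoeffContinuous F) {g : Ω' → Ω} (hg : Continuous g) :
    CoeffContinuous fun ω' => F (g ω') :=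
  fun s => (hF s).comp hg

/-- Finite ordered products of coefficientwise continuous functions are coefficientwise continuous. [cite: SalmhoferSeiler1991, §2 (2.12)] -/
theorem _root_.Literature.MathematicalPhysics.QuantumLattice.GrassmannAlgebra.CoeffContinuous.ofFn_prod
    {κ : Type*} [LinearOrder κ] [Fintype κ] {Ω : Type*} [TopologicalSpace Ω] {n : ℕ}
    {F : Fin n → Ω → GrassmannAlgebra ℂ κ} (hF : ∀ i, CoeffContinuous (F i)) :
    CoeffContinuous fun ω => (List.ofFn fun i => F i ω).prod := by
  induction n with
  | zero => simp only [List.ofFn_zero, List.prod_nil]; exact CoeffContinuous.const 1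
  | succ n ih => simp only [List.ofFn_succ, List.prod_cons]; exact (hF 0).mul (ih fun i => hF i.succ)

/-- A `noncommProd` over a finite type as an ordered list product along an enumeration. [cite: SalmhoferSeiler1991, §2 (2.12)] -/
theorem noncommProd_univ_eq_prod_ofFn {α M : Type*} [Fintype α] [DecidableEq α] [Monoid M] {n : ℕ} (e : Fin n ≃ α)
    (f : α → M) (comm : ((Finset.univ : Finset α) : Set α).Pairwise (Function.onFun Commute f)) :
    Finset.univ.noncommProd f comm = (List.ofFn fun i => f (e i)).prod := by
  have hnd : (List.ofFn e).Nodup := List.nodup_ofFn.2 e.injective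
  have huniv : (List.ofFn e).toFinset = Finset.univ :=
    Finset.eq_univ_of_forall fun a => List.mem_toFinset.2 (List.mem_ofFn.2 ⟨e.symm a, e.apply_symm_apply a⟩)
  have h := Finset.noncommProd_toFinset (List.ofFn ⇑e) f (by rw [huniv]; exact comm) hnd
  rw [List.map_ofFn] at h
  rw [show (fun i => f (e i)) = f ∘ ⇑e from rfl, ← h]
  congr 1
  exact huniv.symm

section GaugeAverage

open _root_.MeasureTheory
open Literature.MathematicalPhysics.QuantumFieldTheory (haarProbability)

variable {B : Type*} [Fintype B] [DecidableEq B]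

/-- The coordinates of the lattice link weight are continuous functions of `U ∈ U(N)` (`x ≠ y`). [cite: SalmhoferSeiler1991, §2 (2.12)] -/
theorem coeffContinuous_linkWeightAt {x y : Λ} (hxy : x ≠ y) (s s' : ℂ) :
    CoeffContinuous fun V : OneLink.UN N => linkWeightAt x y s s' (V : Matrix (Fin N) (Fin N) ℂ) := by
  have h := (OneLink.coeffContinuous_linkWeight (N := N) s s').linearMap (linkEmbed (Λ := Λ) x y).toLinearMap
  have hW : (fun V : OneLink.UN N => linkWeightAt x y s s' (V : Matrix (Fin N) (Fin N) ℂ)) = fun V : OneLink.UN N =>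
      (linkEmbed x y).toLinearMap (OneLink.linkWeight s s' (V : Matrix (Fin N) (Fin N) ℂ)) :=
    funext fun V => by rw [AlgHom.toLinearMap_apply, linkEmbed_linkWeight hxy]
  rw [hW]; exact h

/-- `e^{-S_F}` with the link factors as an ordered product along an enumeration of the links. [cite: SalmhoferSeiler1991, §2 (2.3)] -/
theorem fermiBoltzmann_eq_ofFn (l : B → Λ × Λ) (Γ : B → ℂ) (m : ℂ) {n : ℕ} (e : Fin n ≃ B) (U : B → OneLink.UN N) :
    fermiBoltzmann l Γ m U =
      Finset.univ.noncommProd (fun x => grassmannExp (m • (meson x : FermiAlg Λ N)))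
          (fun x _ _ _ _ => commute_grassmannExp_smul_meson m x _) *
        (List.ofFn fun i => linkWeightAt (l (e i)).1 (l (e i)).2 (-(Γ (e i) / 2)) (Γ (e i) / 2)
          (U (e i) : Matrix (Fin N) (Fin N) ℂ)).prod := by
  rw [fermiBoltzmann_eq, noncommProd_univ_eq_prod_ofFn e]

/-- The coordinates of `e^{-S_F}` are continuous functions of the gauge field (links with distinct
endpoints). [cite: SalmhoferSeiler1991, §2 (2.12)] -/
theorem coeffContinuous_fermiBoltzmann (l : B → Λ × Λ) (hl : ∀ b, (l b).1 ≠ (l b).2) (Γ : B → ℂ) (m : ℂ) :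
    CoeffContinuous (fermiBoltzmann (N := N) l Γ m) := by
  have h := fun U => fermiBoltzmann_eq_ofFn (N := N) l Γ m (Fintype.equivFin B).symm U
  rw [show fermiBoltzmann (N := N) l Γ m = _ from funext h]
  exact (CoeffContinuous.const _).mul (CoeffContinuous.ofFn_prod fun i =>
    (coeffContinuous_linkWeightAt (hl _) _ _).comp (continuous_apply _))

/-- The coordinates of `e^{-S_F}` are integrable for the gauge measure `𝒟U` (a finite measure on
the compact group `U(N)^{links}`). [cite: SalmhoferSeiler1991, §2 (2.12)] -/
theorem coeffIntegrable_fermiBoltzmann (l : B → Λ × Λ) (hl : ∀ b, (l b).1 ≠ (l b).2) (Γ : B → ℂ) (m : ℂ) :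
    CoeffIntegrable (gaugeMeasure N B) (fermiBoltzmann (Λ := Λ) l Γ m) := by
  haveI : SecondCountableTopology (OneLink.UN N) := by
    haveI : SecondCountableTopology (Matrix (Fin N) (Fin N) ℂ) :=
      inferInstanceAs (SecondCountableTopology (Fin N → Fin N → ℂ))
    exact TopologicalSpace.Subtype.secondCountableTopology _
  haveI : IsFiniteMeasureOnCompacts (gaugeMeasure N B) := by unfold gaugeMeasure; infer_instance
  exact (coeffContinuous_fermiBoltzmann l hl Γ m).coeffIntegrable

/-- Coefficientwise integrability of `F · e^{-S_F}` for a continuous family `F(U)`. [cite: SalmhoferSeiler1991, §2 (2.12)] -/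
theorem coeffIntegrable_mul_fermiBoltzmann (l : B → Λ × Λ) (hl : ∀ b, (l b).1 ≠ (l b).2) (Γ : B → ℂ) (m : ℂ)
    {F : (B → OneLink.UN N) → FermiAlg Λ N} (hF : CoeffContinuous F) :
    CoeffIntegrable (gaugeMeasure N B) fun U => F U * fermiBoltzmann l Γ m U := by
  haveI : SecondCountableTopology (OneLink.UN N) := by
    haveI : SecondCountableTopology (Matrix (Fin N) (Fin N) ℂ) :=
      inferInstanceAs (SecondCountableTopology (Fin N → Fin N → ℂ))
    exact TopologicalSpace.Subtype.secondCountableTopology _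
  haveI : IsFiniteMeasureOnCompacts (gaugeMeasure N B) := by unfold gaugeMeasure; infer_instance
  exact (hF.mul (coeffContinuous_fermiBoltzmann l hl Γ m)).coeffIntegrable

/-- **Gauge field integration at strong coupling (Salmhofer–Seiler (2.19)).**  At `β = 0` "the gauge
integration can be done separately on each link" (p. 400): for links with distinct endpoints and
signs `Γ_b² = 1`,
`∫ 𝒟U e^{-S_F} = ∏_x e^{m ψ̄ψ(x)} · ∏_b B̃(¼ ψ̄ψ(x_b) ψ̄ψ(y_b))`
`= exp(∑_x m ψ̄ψ(x) + ∑_b W̃(¼ ψ̄ψ(x_b)ψ̄ψ(y_b)))`, `W̃ = log B̃` (2.18), with `B̃` the Rossi–Wolff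
polynomial (2.16)–(2.17) (`bondFactor`). [cite: SalmhoferSeiler1991, §2 (2.19)] -/
theorem gaugeAverage_eq (l : B → Λ × Λ) (hl : ∀ b, (l b).1 ≠ (l b).2) (Γ : B → ℂ) (hΓ : ∀ b, Γ b ^ 2 = 1)
    (m : ℂ) :
    (gaugeAverage l Γ m : FermiAlg Λ N) =
      Finset.univ.noncommProd (fun x => grassmannExp (m • (meson x : FermiAlg Λ N)))
          (fun x _ _ _ _ => commute_grassmannExp_smul_meson m x _) *
        Finset.univ.noncommProd (fun b => bondFactor (l b).1 (l b).2) (fun _ _ _ _ _ => commute_bondFactor _ _ _) := by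
  set e : Fin (Fintype.card B) ≃ B := (Fintype.equivFin B).symm with he
  set W : B → OneLink.UN N → FermiAlg Λ N := fun b V =>
    linkWeightAt (l b).1 (l b).2 (-(Γ b / 2)) (Γ b / 2) (V : Matrix (Fin N) (Fin N) ℂ) with hW
  have hWc : ∀ b, CoeffContinuous (W b) := fun b => coeffContinuous_linkWeightAt (hl b) _ _
  have hG : CoeffIntegrable (gaugeMeasure N B) fun U : B → OneLink.UN N => (List.ofFn fun i => W (e i) (U (e i))).prod := by
    haveI : SecondCountableTopology (OneLink.UN N) := by
      haveI : SecondCountableTopology (Matrix (Fin N) (Fin N) ℂ) :=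
        inferInstanceAs (SecondCountableTopology (Fin N → Fin N → ℂ))
      exact TopologicalSpace.Subtype.secondCountableTopology _
    haveI : IsFiniteMeasureOnCompacts (gaugeMeasure N B) := by unfold gaugeMeasure; infer_instance
    exact (CoeffContinuous.ofFn_prod fun i => (hWc (e i)).comp (continuous_apply (e i))).coeffIntegrable
  have hpi := cintegral_pi_prod_ofFn e.toEmbedding (haarProbability (OneLink.UN N)) W fun b => (hWc b).coeffIntegrable
  simp only [Equiv.coe_toEmbedding] at hpi
  unfold gaugeAverage
  rw [cintegral_congr fun U => fermiBoltzmann_eq_ofFn l Γ m e U, cintegral_const_mul _ hG]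
  unfold gaugeMeasure
  rw [hpi, noncommProd_univ_eq_prod_ofFn e (fun b => bondFactor (l b).1 (l b).2)]
  congr 2
  exact congrArg List.ofFn (funext fun i => cintegral_linkWeightAt_staggered (hl (e i)) (Γ (e i)) (hΓ (e i)))

/-! ### Expectations of the strongly coupled gauge theory (Salmhofer–Seiler (2.9)–(2.10)) -/

/-- **The unnormalised expectation `∫ 𝒟_Λψψ̄ 𝒟_ΛU e^{-S} f(U, ψ, ψ̄)` at `β = 0`** (the numerator of
(2.10); `S = S_F`, `g₄ = 0`): the Berezin integral of the gauge average of `f(U) e^{-S_F(U)}`. [cite: SalmhoferSeiler1991, §2 (2.9)–(2.10)] -/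
def fermiBracket (l : B → Λ × Λ) (Γ : B → ℂ) (m : ℂ) (F : (B → OneLink.UN N) → FermiAlg Λ N) : ℂ :=
  berezin ℂ _ (cintegral (gaugeMeasure N B) fun U => F U * fermiBoltzmann l Γ m U)

/-- **The partition function `Z_Λ = ∫ 𝒟_Λψψ̄ 𝒟_ΛU e^{-S}`** at `β = 0` (2.9). [cite: SalmhoferSeiler1991, §2 (2.9)] -/
def fermiZ (l : B → Λ × Λ) (Γ : B → ℂ) (m : ℂ) : ℂ := fermiBracket (N := N) l Γ m fun _ => 1

/-- **The expectation `⟨f⟩_{S,Λ} = Z_Λ⁻¹ ∫ 𝒟_Λψψ̄ 𝒟_ΛU e^{-S} f`** at `β = 0` (2.10) (junk `0` if `Z_Λ = 0`). [cite: SalmhoferSeiler1991, §2 (2.10)] -/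
def fermiExpect (l : B → Λ × Λ) (Γ : B → ℂ) (m : ℂ) (F : (B → OneLink.UN N) → FermiAlg Λ N) : ℂ :=
  fermiBracket l Γ m F / fermiZ (N := N) l Γ m

/-- For an observable `F(ψ̄, ψ)` not depending on the gauge field, the gauge integral acts on
`e^{-S_F}` alone: `∫∫ F e^{-S} = ∫dψ̄dψ F · (∫𝒟U e^{-S_F})`. [cite: SalmhoferSeiler1991, §2 (2.10), (2.19)] -/
theorem fermiBracket_const (l : B → Λ × Λ) (hl : ∀ b, (l b).1 ≠ (l b).2) (Γ : B → ℂ) (m : ℂ) (F : FermiAlg Λ N) :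
    fermiBracket l Γ m (fun _ => F) = berezin ℂ _ (F * gaugeAverage l Γ m) := by
  rw [fermiBracket, cintegral_const_mul F (coeffIntegrable_fermiBoltzmann l hl Γ m), gaugeAverage]

/-- Linearity of the unnormalised expectation in a constant observable. [cite: SalmhoferSeiler1991, §2 (2.10)] -/
theorem fermiBracket_const_smul (l : B → Λ × Λ) (hl : ∀ b, (l b).1 ≠ (l b).2) (Γ : B → ℂ) (m : ℂ) (c : ℂ)
    (F : FermiAlg Λ N) : fermiBracket l Γ m (fun _ => c • F) = c * fermiBracket l Γ m (fun _ => F) := by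
  rw [fermiBracket_const l hl, fermiBracket_const l hl, smul_mul_assoc, map_smul, smul_eq_mul]

end GaugeAverage

/-! ### Real polynomials in the rescaled meson fields -/

omit [LinearOrder Λ] [Fintype Λ] in
/-- A product in the centre as a `noncommProd` in the fermion algebra. [cite: SalmhoferSeiler1991, §2 (2.19)] -/
theorem coe_prod_center {α : Type*} [Fintype α] [DecidableEq α] (f : α → Subalgebra.center ℂ (FermiAlg Λ N)) :
    ((∏ i, f i : Subalgebra.center ℂ (FermiAlg Λ N)) : FermiAlg Λ N) =
      Finset.univ.noncommProd (fun i => (f i : FermiAlg Λ N))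
        (fun i _ j _ _ => (Subalgebra.mem_center_iff.1 (f i).2 (f j : FermiAlg Λ N)).symm) := by
  rw [← Finset.noncommProd_eq_prod]
  exact Finset.map_noncommProd Finset.univ f _ (Subalgebra.center ℂ (FermiAlg Λ N)).val

variable (N) in
/-- **Substitution of rescaled meson fields into a REAL polynomial**, `Φ ↦ Φ(c ψ̄ψ)`: the ring
homomorphism `ℝ[σ_x : x ∈ Λ] → centre(Λ[ψ̄, ψ])` (real coefficients as in the complex spin system of
`ComplexSpinInfraredBound`; `c = 1/(2N)` is Salmhofer–Seiler's `σ_x = ψ̄ψ(x)/2N`). [cite: SalmhoferSeiler1991, §2 (2.20)–(2.21)] -/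
def spinObsC (c : ℂ) : MvPolynomial Λ ℝ →+* Subalgebra.center ℂ (FermiAlg Λ N) :=
  (mesonPoly N c).toRingHom.comp (MvPolynomial.map (algebraMap ℝ ℂ))

omit [Fintype Λ] in
/-- `spinObsC` on a variable: `σ_x ↦ c ψ̄ψ(x)`. [cite: SalmhoferSeiler1991, §2 (2.21)] -/
@[simp] theorem spinObsC_X (c : ℂ) (x : Λ) : spinObsC N c (MvPolynomial.X x) = mesonC c x := by
  simp [spinObsC, mesonPoly]

omit [Fintype Λ] in
/-- `spinObsC` on a constant. [cite: SalmhoferSeiler1991, §2 (2.21)] -/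
@[simp] theorem spinObsC_C (c : ℂ) (r : ℝ) :
    spinObsC N c (MvPolynomial.C r) = algebraMap ℂ (Subalgebra.center ℂ (FermiAlg Λ N)) (r : ℂ) := by
  simp [spinObsC, mesonPoly]

omit [LinearOrder Λ] [Fintype Λ] in
/-- The value of a constant. [cite: SalmhoferSeiler1991, §2 (2.21)] -/
theorem coe_algebraMap_center (r : ℂ) :
    ((algebraMap ℂ (Subalgebra.center ℂ (FermiAlg Λ N)) r : Subalgebra.center ℂ (FermiAlg Λ N)) : FermiAlg Λ N) =
      r • (1 : FermiAlg Λ N) := by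
  rw [Subalgebra.coe_algebraMap, Algebra.algebraMap_eq_smul_one]

/-- **Bosonisation for real polynomials**: `∫dψ̄dψ Φ(c ψ̄ψ) = ε (c^N N!)^{|Λ|} · [∏_x σ_x^N] Φ`. [cite: SalmhoferSeiler1991, §2 (2.20)] -/
theorem berezin_spinObsC (c : ℂ) (Φ : MvPolynomial Λ ℝ) :
    berezin ℂ _ ((spinObsC N c Φ : Subalgebra.center ℂ (FermiAlg Λ N)) : FermiAlg Λ N) =
      sgn (Fintype.card (CIdx Λ N)) * (c ^ N * (N.factorial : ℂ)) ^ Fintype.card Λ *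
        ((MvPolynomial.coeff (topExp Λ N) Φ : ℝ) : ℂ) := by
  rw [spinObsC, RingHom.comp_apply, AlgHom.toRingHom_eq_coe, AlgHom.coe_toRingHom, berezin_mesonPoly,
    MvPolynomial.coeff_map]
  rfl

end Lattice

/-! ### The `β = 0` `U(N)` theory on the torus IS the complex spin system (Salmhofer–Seiler (2.21)–(2.24), Remark 3.4(2)) -/

section Torus

open _root_.MeasureTheory MvPolynomial
open Literature.Probability.LatticeModels (TorusSite)
open Literature.MathematicalPhysics.StatisticalMechanics

variable {ν L : ℕ} [NeZero L] [LinearOrder (TorusSite ν L)] {N : ℕ}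

/-- The links of the torus `(ℤ/Lℤ)^ν`: `(x, μ) ↦ (x, x + e_μ)` (the sum `∑_{x,μ}` of (2.3), (2.19), (2.21)). [cite: SalmhoferSeiler1991, §2 (2.3)] -/
def torusLinks (ν L : ℕ) : TorusSite ν L × Fin ν → TorusSite ν L × TorusSite ν L :=
  fun p => (p.1, p.1 + Pi.single p.2 1)

omit [NeZero L] [LinearOrder (TorusSite ν L)] in
/-- On a torus of side `L ≥ 2` every link has two distinct endpoints. [cite: SalmhoferSeiler1991, §2 (2.1)] -/
theorem torusLinks_ne (hL : 1 < L) (p : TorusSite ν L × Fin ν) : (torusLinks ν L p).1 ≠ (torusLinks ν L p).2 := by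
  haveI : Fact (1 < L) := ⟨hL⟩
  intro h
  have h1 : (Pi.single p.2 (1 : ZMod L) : TorusSite ν L) = 0 := by
    have := congrArg (fun z => z - p.1) h
    simpa [torusLinks] using this.symm
  have h2 := congrFun h1 p.2
  simp at h2

/-- **The bosonised observable**: the spin polynomial `Φ(σ)` read as the fermionic observable
`Φ(ψ̄ψ/2N)` ("`σ_x = σ̃/2N` … `σ̃` replaces `∑_a ψ̄_aψ_a`", p. 401). [cite: SalmhoferSeiler1991, §2 (2.21)] -/
def spinObs (Φ : MvPolynomial (TorusSite ν L) ℝ) : FermiAlg (TorusSite ν L) N :=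
  (spinObsC N ((2 * N : ℂ)⁻¹) Φ : Subalgebra.center ℂ (FermiAlg (TorusSite ν L) N))

omit [NeZero L] in
/-- `spinObs` is multiplicative. [cite: SalmhoferSeiler1991, §2 (2.21)] -/
theorem spinObs_mul (Φ Ψ : MvPolynomial (TorusSite ν L) ℝ) :
    (spinObs (Φ * Ψ) : FermiAlg (TorusSite ν L) N) = spinObs Φ * spinObs Ψ := by
  rw [spinObs, map_mul, Subalgebra.coe_mul, spinObs, spinObs]

omit [NeZero L] in
/-- `spinObs 1 = 1`. [cite: SalmhoferSeiler1991, §2 (2.21)] -/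
theorem spinObs_one : (spinObs 1 : FermiAlg (TorusSite ν L) N) = 1 := by
  rw [spinObs, map_one, Subalgebra.coe_one]

omit [NeZero L] in
/-- `spinObs σ_x = ψ̄ψ(x)/(2N)`. [cite: SalmhoferSeiler1991, §2 (2.21), (2.24)] -/
theorem spinObs_X (x : TorusSite ν L) :
    (spinObs (MvPolynomial.X x) : FermiAlg (TorusSite ν L) N) = (2 * N : ℂ)⁻¹ • meson x := by
  rw [spinObs, spinObsC_X, coe_mesonC]

omit [NeZero L] in
/-- `spinObs (σ_x σ_y) = (ψ̄ψ(x)/2N)(ψ̄ψ(y)/2N)`. [cite: SalmhoferSeiler1991, §2 (2.21), (2.24)] -/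
theorem spinObs_X_mul_X (x y : TorusSite ν L) :
    (spinObs (MvPolynomial.X x * MvPolynomial.X y) : FermiAlg (TorusSite ν L) N) =
      ((2 * N : ℂ)⁻¹ • meson x) * ((2 * N : ℂ)⁻¹ • meson y) := by
  rw [spinObs_mul, spinObs_X, spinObs_X]

/-- The scalar identity behind `F(σ_x) = e^{2Nmσ_x} ↦ e^{m ψ̄ψ(x)}`. [cite: SalmhoferSeiler1991, §2 (2.21)] -/
theorem siteWeight_scalar (m : ℝ) {j : ℕ} (hj : j < N + 1) :
    (((2 * N * m) ^ j / (j.factorial : ℝ) : ℝ) : ℂ) * ((2 * N : ℂ)⁻¹) ^ j = (m : ℂ) ^ j / (j.factorial : ℂ) := by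
  rcases Nat.eq_zero_or_pos N with rfl | hN
  · have hj0 : j = 0 := by omega
    subst hj0; simp
  · have h2N : (2 * N : ℂ) ≠ 0 := by exact_mod_cast (by omega : 2 * N ≠ 0)
    push_cast
    rw [mul_pow, inv_pow, div_mul_eq_mul_div, mul_right_comm, mul_inv_cancel₀ (pow_ne_zero _ h2N), one_mul]

/-- The scalar identity behind `B(σ_xσ_y) ↦ B̃(¼ ψ̄ψ(x)ψ̄ψ(y))`: `b_k = b̃_k N^{2k}` (2.23) and
`(N/2N)^{2k} = (¼)^k`. [cite: SalmhoferSeiler1991, §2 (2.23)] -/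
theorem bondWeight_scalar {k : ℕ} (hk : k < N + 1) :
    ((ComplexSpin.uNBondCoeff N k : ℝ) : ℂ) * ((2 * N : ℂ)⁻¹ * (2 * N : ℂ)⁻¹) ^ k =
      ((N - k).factorial : ℂ) / ((N.factorial : ℂ) * (k.factorial : ℂ)) * (1 / 4 : ℂ) ^ k := by
  rw [ComplexSpin.uNBondCoeff, if_pos (Nat.lt_succ_iff.1 hk)]
  rcases Nat.eq_zero_or_pos N with rfl | hN
  · have hk0 : k = 0 := by omega
    subst hk0; simp
  · have hN' : (N : ℂ) ≠ 0 := by exact_mod_cast hN.ne'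
    have hkey : ((2 * N : ℂ)⁻¹ * (2 * N : ℂ)⁻¹) ^ k = ((N : ℂ) ^ (2 * k))⁻¹ * (1 / 4 : ℂ) ^ k := by
      have h1 : (2 * N : ℂ)⁻¹ * (2 * N : ℂ)⁻¹ = ((N : ℂ) ^ 2)⁻¹ * (1 / 4) := by
        field_simp; ring
      rw [h1, mul_pow, inv_pow, ← pow_mul]
    push_cast
    rw [hkey, mul_assoc, ← mul_assoc ((N : ℂ) ^ (2 * k)), mul_inv_cancel₀ (pow_ne_zero _ hN'), one_mul]

omit [NeZero L] in
/-- **Site weight**: `spinObs (F^{≤N}(σ_x)) = ∑_{j≤N} (2Nm)^j/j! (ψ̄ψ(x)/2N)^j = e^{m ψ̄ψ(x)}`. [cite: SalmhoferSeiler1991, §2 (2.19), (2.21)] -/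
theorem spinObs_siteWeight (m : ℝ) (x : TorusSite ν L) :
    (spinObs (ComplexSpin.siteWeight N m x) : FermiAlg (TorusSite ν L) N) = grassmannExp ((m : ℂ) • meson x) := by
  rw [grassmannExp_smul_meson, spinObs, ComplexSpin.siteWeight, map_sum, AddSubmonoidClass.coe_finsetSum]
  refine Finset.sum_congr rfl fun j hj => ?_
  rw [map_mul, map_pow, spinObsC_C, spinObsC_X, Subalgebra.coe_mul, SubmonoidClass.coe_pow, coe_algebraMap_center,
    coe_mesonC, smul_pow, smul_mul_assoc, one_mul, smul_smul, siteWeight_scalar m (Finset.mem_range.1 hj)]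

omit [NeZero L] in
/-- **Bond weight**: `spinObs (B^{≤N}(σ_xσ_y)) = ∑_k b_k (ψ̄ψ(x)ψ̄ψ(y)/4N²)^k = B̃(¼ ψ̄ψ(x)ψ̄ψ(y))`
for the `U(N)` data `b_k = (N-k)!N^{2k}/(N!k!)` (2.23). [cite: SalmhoferSeiler1991, §2 (2.16)–(2.17), (2.23)] -/
theorem spinObs_bondWeight (x y : TorusSite ν L) :
    (spinObs (ComplexSpin.bondWeight N (ComplexSpin.uNBondCoeff N) x y) : FermiAlg (TorusSite ν L) N) =
      bondFactor x y := by
  rw [bondFactor, spinObs, ComplexSpin.bondWeight, map_sum, AddSubmonoidClass.coe_finsetSum]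
  refine Finset.sum_congr rfl fun k hk => ?_
  rw [map_mul, map_pow, map_mul, spinObsC_C, spinObsC_X, spinObsC_X, Subalgebra.coe_mul, SubmonoidClass.coe_pow,
    coe_algebraMap_center, Subalgebra.coe_mul, coe_mesonC, coe_mesonC, smul_mul_assoc, one_mul, smul_mul_smul_comm,
    smul_pow, smul_smul, smul_pow, smul_smul, bondWeight_scalar (Finset.mem_range.1 hk)]

/-- **The gauge average on the torus is the Boltzmann polynomial of the complex spin system read
in the meson fields**: `∫𝒟U e^{-S_F} = ∏_x F(σ_x) ∏_{x,μ} B(σ_xσ_{x+e_μ})` at `σ = ψ̄ψ/2N` — the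
content of (2.19)–(2.23) (any signs `Γ² = 1`, in particular the staggered phases (2.4) with
antiperiodic or periodic fermion boundary conditions; `L ≥ 2`). [cite: SalmhoferSeiler1991, §2 (2.19)–(2.23)] -/
theorem gaugeAverage_torus (hL : 1 < L) (Γ : TorusSite ν L × Fin ν → ℂ) (hΓ : ∀ b, Γ b ^ 2 = 1) (m : ℝ) :
    (gaugeAverage (torusLinks ν L) Γ (m : ℂ) : FermiAlg (TorusSite ν L) N) =
      spinObs (ComplexSpin.boltzmann N m (ComplexSpin.uNBondCoeff N)) := by
  rw [gaugeAverage_eq _ (torusLinks_ne hL) Γ hΓ, spinObs, ComplexSpin.boltzmann, map_mul, map_prod, map_prod,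
    Finset.prod_congr rfl fun x _ => map_prod (spinObsC N ((2 * N : ℂ)⁻¹)) _ _, ← Fintype.prod_prod_type',
    Subalgebra.coe_mul, coe_prod_center, coe_prod_center]
  congr 1
  · exact Finset.noncommProd_congr rfl (fun x _ => (spinObs_siteWeight m x).symm) _
  · exact Finset.noncommProd_congr rfl (fun p _ => (spinObs_bondWeight p.1 _).symm) _

variable (ν L N) in
/-- The global constant `ε (N!)^{|Λ|} (2N)^{-N|Λ|}` dropped in (2.21) ("Dropping global constants").
[cite: SalmhoferSeiler1991, §2 (2.21)] -/
def normConst : ℂ :=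
  sgn (Fintype.card (CIdx (TorusSite ν L) N)) * (((2 * N : ℂ)⁻¹) ^ N * (N.factorial : ℂ)) ^ Fintype.card (TorusSite ν L)

omit [LinearOrder (TorusSite ν L)] in
/-- The global constant is nonzero. [cite: SalmhoferSeiler1991, §2 (2.21)] -/
theorem normConst_ne_zero : normConst ν L N ≠ 0 := by
  have hpow : ((2 * N : ℂ)⁻¹) ^ N ≠ 0 := by
    rcases Nat.eq_zero_or_pos N with hN | hN
    · subst hN; simp
    · exact pow_ne_zero _ (inv_ne_zero (by exact_mod_cast (by omega : 2 * N ≠ 0)))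
  exact mul_ne_zero (sgn_ne_zero _)
    (pow_ne_zero _ (mul_ne_zero hpow (by exact_mod_cast (Nat.factorial_pos N).ne')))

/-- **Salmhofer–Seiler (2.21) / Remark 3.4(2), unnormalised and with the constants kept**: for every
real polynomial `Φ` in the spins,
`∫ 𝒟ψψ̄ 𝒟U e^{-S} Φ(ψ̄ψ/2N) = ε (N!)^{|Λ|}(2N)^{-N|Λ|} · [Φ]_Λ`, where `[Φ]_Λ` is the complex-spin
bracket `ComplexSpin.bracket N m (uNBondCoeff N) Φ` (coefficient of `∏_x σ_x^N` in
`Φ ∏_x e^{2Nmσ_x} ∏_{x,μ} B(σ_xσ_{x+e_μ})`, Remark 3.2) of the `U(N)` system (2.22)–(2.23). [cite: SalmhoferSeiler1991, §2 (2.21) and Remark 3.4(2)] -/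
theorem fermiBracket_spinObs (hL : 1 < L) (Γ : TorusSite ν L × Fin ν → ℂ) (hΓ : ∀ b, Γ b ^ 2 = 1) (m : ℝ)
    (Φ : MvPolynomial (TorusSite ν L) ℝ) :
    fermiBracket (torusLinks ν L) Γ (m : ℂ) (fun _ => (spinObs Φ : FermiAlg (TorusSite ν L) N)) =
      normConst ν L N * (ComplexSpin.bracket N m (ComplexSpin.uNBondCoeff N) Φ : ℂ) := by
  rw [fermiBracket_const _ (torusLinks_ne hL), gaugeAverage_torus hL Γ hΓ m, ← spinObs_mul, spinObs,
    berezin_spinObsC, normConst, ComplexSpin.bracket]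
  rfl

/-- **The partition functions agree up to the global constant**: `Z_Λ^{gauge} = ε(N!)^{|Λ|}(2N)^{-N|Λ|} Z_Λ^{spin}`. [cite: SalmhoferSeiler1991, §2 (2.19)–(2.21)] -/
theorem fermiZ_eq (hL : 1 < L) (Γ : TorusSite ν L × Fin ν → ℂ) (hΓ : ∀ b, Γ b ^ 2 = 1) (m : ℝ) :
    fermiZ (N := N) (torusLinks ν L) Γ (m : ℂ) =
      normConst ν L N * (ComplexSpin.partitionFunction (ν := ν) (L := L) N m (ComplexSpin.uNBondCoeff N) : ℂ) := by
  rw [fermiZ, show (fun _ : TorusSite ν L × Fin ν → OneLink.UN N => (1 : FermiAlg (TorusSite ν L) N)) =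
    fun _ => spinObs 1 from funext fun _ => spinObs_one.symm, fermiBracket_spinObs hL Γ hΓ,
    ComplexSpin.partitionFunction]

/-- **Salmhofer–Seiler (2.21): expectations of the `β = 0` `U(N)` lattice gauge theory with
staggered fermions are those of the complex spin system**, `⟨Φ(ψ̄ψ/2N)⟩_{S,Λ} = ⟨Φ⟩_Λ`, for every
real polynomial `Φ` (the global constants cancel). [cite: SalmhoferSeiler1991, §2 (2.21)] -/
theorem fermiExpect_spinObs (hL : 1 < L) (Γ : TorusSite ν L × Fin ν → ℂ) (hΓ : ∀ b, Γ b ^ 2 = 1) (m : ℝ)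
    (Φ : MvPolynomial (TorusSite ν L) ℝ) :
    fermiExpect (torusLinks ν L) Γ (m : ℂ) (fun _ => (spinObs Φ : FermiAlg (TorusSite ν L) N)) =
      (ComplexSpin.expect N m (ComplexSpin.uNBondCoeff N) Φ : ℂ) := by
  rw [fermiExpect, fermiBracket_spinObs hL Γ hΓ, fermiZ_eq hL Γ hΓ, ComplexSpin.expect,
    mul_div_mul_left _ _ normConst_ne_zero, Complex.ofReal_div]

/-- **Salmhofer–Seiler (2.24): `⟨ψ̄ψ(x)⟩_Λ = 2N ⟨σ_x⟩_Λ`.** [cite: SalmhoferSeiler1991, §2 (2.24)] -/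
theorem fermiExpect_meson (hL : 1 < L) (Γ : TorusSite ν L × Fin ν → ℂ) (hΓ : ∀ b, Γ b ^ 2 = 1) (m : ℝ)
    (x : TorusSite ν L) :
    fermiExpect (torusLinks ν L) Γ (m : ℂ) (fun _ => (meson x : FermiAlg (TorusSite ν L) N)) =
      2 * N * (ComplexSpin.expect N m (ComplexSpin.uNBondCoeff N) (MvPolynomial.X x) : ℂ) := by
  rcases Nat.eq_zero_or_pos N with hN | hN
  · subst hN
    have h0 : (meson x : FermiAlg (TorusSite ν L) 0) = 0 := by simp [meson]
    rw [h0, fermiExpect, show (fun _ : TorusSite ν L × Fin ν → OneLink.UN 0 => (0 : FermiAlg (TorusSite ν L) 0)) =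
      fun _ => (0 : ℂ) • (1 : FermiAlg (TorusSite ν L) 0) from funext fun _ => (zero_smul _ _).symm,
      fermiBracket_const_smul _ (torusLinks_ne hL)]
    simp
  · have h2N : (2 * N : ℂ) ≠ 0 := by exact_mod_cast (by omega : 2 * N ≠ 0)
    rw [← fermiExpect_spinObs hL Γ hΓ m, spinObs_X, fermiExpect, fermiExpect,
      fermiBracket_const_smul _ (torusLinks_ne hL), ← mul_div_assoc, ← mul_assoc, mul_inv_cancel₀ h2N, one_mul]

/-- **Chiral long-range order at the gauge level (Salmhofer–Seiler Cor. 4.9 with (2.21)/(2.24))**: for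
`1 ≤ N ≤ 4` and `ν ≥ 4` there are `c > 0` and `L₀` such that for the `β = 0` `U(N)` lattice gauge
theory with massless staggered fermions on every even torus `(ℤ/Lℤ)^ν`, `L ≥ L₀` (any linear order
of the sites, any link signs `Γ² = 1`),
`|Λ|⁻¹ ∑_x ⟨(ψ̄ψ(0)/2N)(ψ̄ψ(x)/2N)⟩_Λ ≥ c`; the expectation is the (real) complex-spin correlation
`⟨σ_0σ_x⟩_Λ` by (2.21), for which this is `ComplexSpin.uN_chiralLRO_of_four_le`. [cite: SalmhoferSeiler1991, Cor. 4.9 and (2.21)] -/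
theorem chiralLRO_gauge (hN1 : 1 ≤ N) (hN4 : N ≤ 4) (hν : 4 ≤ ν) :
    ∃ c : ℝ, 0 < c ∧ ∃ L₀ : ℕ, ∀ (L : ℕ) [NeZero L] [LinearOrder (TorusSite ν L)]
      (Γ : TorusSite ν L × Fin ν → ℂ), (∀ b, Γ b ^ 2 = 1) → Even L → L₀ ≤ L →
        c ≤ (Fintype.card (TorusSite ν L) : ℝ)⁻¹ *
          ∑ x : TorusSite ν L, (fermiExpect (torusLinks ν L) Γ ((0 : ℝ) : ℂ)
            (fun _ => (((2 * N : ℂ)⁻¹ • meson 0) * ((2 * N : ℂ)⁻¹ • meson x) : FermiAlg (TorusSite ν L) N))).re := by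
  obtain ⟨c, hc, L₀, hL₀⟩ := ComplexSpin.uN_chiralLRO_of_four_le (ν := ν) hN1 hN4 hν
  refine ⟨c, hc, max L₀ 2, fun L _ _ Γ hΓ hE hL => ?_⟩
  have hL1 : 1 < L := by have := le_max_right L₀ 2; omega
  have key := hL₀ L hE ((le_max_left L₀ 2).trans hL)
  refine key.trans_eq ?_
  congr 1
  refine Finset.sum_congr rfl fun x _ => ?_
  rw [← spinObs_X_mul_X, fermiExpect_spinObs hL1 Γ hΓ, Complex.ofReal_re]

end Torus

/-! ### Faithfulness: the action is `ψ̄(-D)ψ` for the tree's staggered Dirac operator (Salmhofer–Seiler (2.3)–(2.4)) -/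

section StaggeredDirac

open Literature.MathematicalPhysics.QuantumFieldTheory (GaugeConfig)
open Literature.Probability.LatticeModels (TorusSite)

variable {ν L : ℕ} [NeZero L] [LinearOrder (TorusSite ν L)] {N : ℕ}

/-- The inverse link variable in the fundamental representation is the adjoint matrix. [cite: SalmhoferSeiler1991, §2 (2.3)] -/
theorem unitaryFundamentalRep_inv (U : OneLink.UN N) :
    unitaryFundamentalRep (Fin N) ℂ U⁻¹ = (U : Matrix (Fin N) (Fin N) ℂ)ᴴ := by
  rw [unitaryFundamentalRep_apply, Matrix.UnitaryGroup.inv_val, Matrix.star_eq_conjTranspose]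

/-- Collapsing a Kronecker delta `[y = t μ]` summed over `y`. [cite: SalmhoferSeiler1991, §2 (2.3)] -/
theorem sum_sum_sum_ite_eq {α β γ M : Type*} [Fintype α] [DecidableEq α] [Fintype β] [Fintype γ]
    [AddCommMonoid M] (t : γ → α) (f : α → β → γ → M) :
    ∑ y, ∑ b, ∑ μ, (if y = t μ then f y b μ else 0) = ∑ b, ∑ μ, f (t μ) b μ := by
  rw [Finset.sum_comm]
  refine Finset.sum_congr rfl fun b _ => ?_
  rw [Finset.sum_comm]
  refine Finset.sum_congr rfl fun μ _ => ?_
  rw [Finset.sum_ite_eq', if_pos (Finset.mem_univ _)]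

/-- Collapsing a Kronecker delta `[x = y + e μ]` summed over `y`. [cite: SalmhoferSeiler1991, §2 (2.3)] -/
theorem sum_sum_sum_ite_eq_sub {α β γ M : Type*} [AddCommGroup α] [Fintype α] [DecidableEq α] [Fintype β]
    [Fintype γ] [AddCommMonoid M] (x : α) (e : γ → α) (f : α → β → γ → M) :
    ∑ y, ∑ b, ∑ μ, (if x = y + e μ then f y b μ else 0) = ∑ b, ∑ μ, f (x - e μ) b μ := by
  have h : ∀ y μ, (x = y + e μ) = (y = x - e μ) := fun y μ =>
    propext ⟨fun h => by rw [h, add_sub_cancel_right], fun h => by rw [h, sub_add_cancel]⟩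
  simp_rw [h]
  exact sum_sum_sum_ite_eq (fun μ => x - e μ) f

omit [NeZero L] [LinearOrder (TorusSite ν L)] in
/-- The staggered phase ignores the coordinate `μ`: `η_μ(x + e_μ) = η_μ(x)`. [cite: SalmhoferSeiler1991, §2 (2.4)] -/
theorem staggeredPhase_add_single (x : TorusSite ν L) (μ : Fin ν) :
    staggeredPhase (x + Pi.single μ 1) μ = staggeredPhase x μ :=
  staggeredPhase_shift x μ

/-- **`-S_F` is `ψ̄(-D)ψ` for the tree's gauge-covariant staggered Dirac operator** `D = staggeredDirac ρ U (-m)`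
(`GrassmannIntegral.lean`, Montvay–Münster (5.7) with `K = ½`; `ρ` the fundamental representation of
`U(N)`, mass entered as `-m` because Salmhofer–Seiler's (2.3) carries `-m ψ̄ψ(x)` inside `S_F` and the
weight is `e^{-S}`), with the staggered signs `Γ_μ(x) = η_μ(x) = (-1)^{x_1+⋯+x_{μ-1}}` (2.4) and the
periodic torus links `(x, x + e_μ)`; the generators are indexed through `toLex`. [cite: SalmhoferSeiler1991, §2 (2.3)–(2.4)] -/
theorem negAction_torus_eq_staggeredDirac (U : GaugeConfig ν L (OneLink.UN N)) (m : ℝ) :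
    negAction (torusLinks ν L) (fun p => ((staggeredPhase p.1 p.2 : ℤ) : ℂ)) (m : ℂ) U =
      ∑ p : TorusSite ν L × Fin N, ∑ q : TorusSite ν L × Fin N,
        (-staggeredDirac (unitaryFundamentalRep (Fin N) ℂ) U (-m)) p q • (pair (toLex p) (toLex q) : FermiAlg (TorusSite ν L) N) := by
  -- expand the Dirac operator into mass, forward and backward parts
  have hD : ∀ p q : TorusSite ν L × Fin N, (-staggeredDirac (unitaryFundamentalRep (Fin N) ℂ) U (-m)) p q =
      (if p = q then (m : ℂ) else 0) +
      ((∑ μ : Fin ν, if q.1 = p.1 + Pi.single μ 1 then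
          -(((staggeredPhase p.1 μ : ℤ) : ℂ) / 2) * (U (p.1, μ) : Matrix (Fin N) (Fin N) ℂ) p.2 q.2 else 0) +
       (∑ μ : Fin ν, if p.1 = q.1 + Pi.single μ 1 then
          (((staggeredPhase p.1 μ : ℤ) : ℂ) / 2) * (U (q.1, μ) : Matrix (Fin N) (Fin N) ℂ)ᴴ p.2 q.2 else 0)) := by
    intro p q
    rw [Matrix.neg_apply, staggeredDirac, Matrix.of_apply, neg_add, Finset.mul_sum, ← Finset.sum_neg_distrib,
      ← Finset.sum_add_distrib]
    congr 1
    · split_ifs <;> simp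
    · refine Finset.sum_congr rfl fun μ _ => ?_
      rw [unitaryFundamentalRep_inv, unitaryFundamentalRep_apply, QuantumFieldTheory.Site.shift,
        QuantumFieldTheory.Site.shift]
      split_ifs <;> ring
  simp_rw [hD, add_smul, Finset.sum_add_distrib, Finset.sum_smul, ite_smul, zero_smul]
  rw [negAction, Finset.sum_add_distrib]
  congr 1
  · -- mass term `∑_x m ψ̄ψ(x)`
    simp only [Finset.sum_ite_eq, Finset.mem_univ, if_true, meson, Finset.smul_sum, cidx]
    rw [Fintype.sum_prod_type]
  congr 1
  · -- forward hopping `-½ Γ_μ(x) ψ̄(x) U ψ(x + e_μ)`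
    simp only [Fintype.sum_prod_type, torusLinks, hopAt, Finset.smul_sum, smul_smul, cidx]
    simp_rw [sum_sum_sum_ite_eq]
    exact Finset.sum_congr rfl fun x _ =>
      ((Finset.sum_congr rfl fun _ _ => Finset.sum_comm).trans Finset.sum_comm).symm
  · -- backward hopping `+½ Γ_μ(x) ψ̄(x + e_μ) U† ψ(x)`: reindex `x ↦ x - e_μ`
    simp only [Fintype.sum_prod_type, torusLinks, hopAt, Finset.smul_sum, smul_smul, cidx]
    simp_rw [sum_sum_sum_ite_eq_sub]
    refine Eq.trans ?_ (Finset.sum_congr rfl fun x _ =>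
      ((Finset.sum_congr rfl fun _ _ => Finset.sum_comm).trans Finset.sum_comm).symm)
    rw [Finset.sum_comm]
    conv_rhs => rw [Finset.sum_comm]
    refine Finset.sum_congr rfl fun μ _ => ?_
    conv_rhs => rw [← Equiv.sum_comp (Equiv.addRight (Pi.single μ (1 : ZMod L) : TorusSite ν L))]
    simp only [Equiv.coe_addRight, add_sub_cancel_right, staggeredPhase_add_single]
omit [NeZero L] [LinearOrder (TorusSite ν L)] in
/-- The staggered signs square to one: `Γ_μ(x)² = 1`. [cite: SalmhoferSeiler1991, §2 (2.4)] -/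
theorem staggeredPhase_sq (x : TorusSite ν L) (μ : Fin ν) : (((staggeredPhase x μ : ℤ) : ℂ)) ^ 2 = 1 := by
  rcases Int.units_eq_one_or (staggeredPhase x μ) with h | h <;> simp [h]

/-- **`e^{-S_F} = exp(ψ̄(-D)ψ)`** on the torus with the staggered signs, `D` the tree's staggered Dirac
operator at mass `-m` in the fundamental representation of `U(N)`. [cite: SalmhoferSeiler1991, §2 (2.3), (2.9)] -/
theorem fermiBoltzmann_torus_eq_staggeredDirac (U : GaugeConfig ν L (OneLink.UN N)) (m : ℝ) :
    fermiBoltzmann (torusLinks ν L) (fun p => ((staggeredPhase p.1 p.2 : ℤ) : ℂ)) (m : ℂ) U =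
      grassmannExp (∑ p : TorusSite ν L × Fin N, ∑ q : TorusSite ν L × Fin N,
        (-staggeredDirac (unitaryFundamentalRep (Fin N) ℂ) U (-m)) p q •
          (pair (toLex p) (toLex q) : FermiAlg (TorusSite ν L) N)) := by
  rw [fermiBoltzmann, negAction_torus_eq_staggeredDirac]

/-- **Cor. 4.9 at the gauge level for the staggered action itself** (signs `Γ_μ(x)` of (2.4), periodic
links `(x, x+e_μ)`, `e^{-S_F} = exp(ψ̄(-D)ψ)` with the tree's `staggeredDirac`): for `1 ≤ N ≤ 4`, `ν ≥ 4`,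
`|Λ|⁻¹ ∑_x ⟨(ψ̄ψ(0)/2N)(ψ̄ψ(x)/2N)⟩_Λ ≥ c > 0` at `m = 0` on all large even tori. [cite: SalmhoferSeiler1991, Cor. 4.9 and (2.21)] -/
theorem chiralLRO_gauge_staggered (hN1 : 1 ≤ N) (hN4 : N ≤ 4) (hν : 4 ≤ ν) :
    ∃ c : ℝ, 0 < c ∧ ∃ L₀ : ℕ, ∀ (L : ℕ) [NeZero L] [LinearOrder (TorusSite ν L)], Even L → L₀ ≤ L →
      c ≤ (Fintype.card (TorusSite ν L) : ℝ)⁻¹ *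
        ∑ x : TorusSite ν L, (fermiExpect (torusLinks ν L) (fun p => ((staggeredPhase p.1 p.2 : ℤ) : ℂ)) ((0 : ℝ) : ℂ)
          (fun _ => (((2 * N : ℂ)⁻¹ • meson 0) * ((2 * N : ℂ)⁻¹ • meson x) : FermiAlg (TorusSite ν L) N))).re := by
  obtain ⟨c, hc, L₀, h⟩ := chiralLRO_gauge (ν := ν) hN1 hN4 hν
  exact ⟨c, hc, L₀, fun L _ _ hE hL => h L _ (fun p => staggeredPhase_sq p.1 p.2) hE hL⟩

end StaggeredDirac

end StrongCoupling

end Literature.MathematicalPhysics.QuantumLattice
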